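import Literature.Analysis.PDE.ConservationLawSlabIBP

/-!
# Classical solutions: differentiability a.e., the pointwise system, and the entropy equality

Topic `Literature/Analysis/PDE`. Fourth layer of the formalization of Dafermos' weak–strong
uniqueness theorem (`Literature.Analysis.PDE.ConservationLaw.dafermos_weak_strong_uniqueness`,
Dafermos 2000, Thm 5.2.1). A classical solution in the sense of the tree
(`IsClassicalSolution`: a weak solution which is Lipschitz on the compact boxes
`[0,T'] × B̄(0,R)`) is treated as in Dafermos §4.1, p. 110 ("bounded, locally Lipschitz, …
satisfies (4.1.1) almost everywhere"; "any weak solution which is locally Lipschitz is necessarily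
a classical solution") and §4.3, p. 113 ("all classical solutions … satisfy (4.3.4) as
equalities"):

* `exists_lipschitzOnWith_of_contDiffOn_convex` — smooth functions on `𝒪` are Lipschitz on a convex
  compact `𝒟 ⊆ 𝒪`; `exists_lipschitz_extension` — a global Lipschitz extension of `θ ∘ Ū` from a
  box (McShane, `LipschitzOnWith.extend_real`);
* `ae_differentiableAt_uncurry` — Rademacher on the box
  (`LipschitzOnWith.ae_differentiableWithinAt_of_mem`);
* `classical_ae_pde` — **the system holds a.e.**: `∂ₜŪ + ∑_α DG_α(Ū) ∂_αŪ = 0` at a.e. point of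
  the open box, from the weak formulation by Lipschitz integration by parts and du Bois-Reymond
  (`IsOpen.ae_eq_zero_of_integral_contDiff_smul_eq_zero`);
* `classical_entropy_eq` — **the entropy equality with its initial term** for `C¹` test functions
  supported in `(-∞,T') × B(0,R)`:
  `∫_{slab} [Dψ(1,0) η(Ū) + ∑_α Dψ(0,e_α) q_α(Ū)] + ∫ ψ(0,x) η(Ū(0,x)) dx = 0`,
  by the slab integration by parts of `ConservationLawSlabIBP` and (4.3.1) `Dq_α = Dη DG_α`.

[cite: Dafermos2000, §4.1 p. 110 and §4.3 p. 113]

## References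

* C. M. Dafermos, *Hyperbolic Conservation Laws in Continuum Physics*, Springer 2000, §4.1, §4.3,
  §5.2 [Dafermos2000].
-/

noncomputable section

open MeasureTheory Set Filter Metric ContinuousLinearMap
open scoped Topology NNReal BigOperators

namespace Literature.Analysis.PDE.ConservationLaw

variable {m n : ℕ}

/-! ## Lipschitz bounds and extensions -/

/-- A `C¹` function on an open set `O` is Lipschitz on every convex compact `D ⊆ O`. [folklore] -/
theorem exists_lipschitzOnWith_of_contDiffOn_convex {F W : Type*} [NormedAddCommGroup F]
    [NormedSpace ℝ F] [NormedAddCommGroup W] [NormedSpace ℝ W] {O D : Set F} (hO : IsOpen O)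
    {θ : F → W} (hθ : ContDiffOn ℝ 1 θ O) (hD : D ⊆ O) (hDc : IsCompact D) (hDconv : Convex ℝ D) :
    ∃ L : ℝ≥0, LipschitzOnWith L θ D := by
  have hcont : ContinuousOn (fderiv ℝ θ) O := hθ.continuousOn_fderiv_of_isOpen hO le_rfl
  obtain ⟨C, hC⟩ := hDc.exists_bound_of_continuousOn (hcont.mono hD)
  refine ⟨(max C 0).toNNReal, ?_⟩
  refine hDconv.lipschitzOnWith_of_nnnorm_fderiv_le (𝕜 := ℝ) (fun x hx => ?_) (fun x hx => ?_)
  · exact (hθ.differentiableOn one_ne_zero x (hD hx)).differentiableAt (hO.mem_nhds (hD hx))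
  · rw [← NNReal.coe_le_coe, coe_nnnorm, Real.coe_toNNReal _ (le_max_right _ _)]
    exact (hC x hx).trans (le_max_left _ _)

/-- A continuous function on `O` is bounded on a compact `D ⊆ O`. [folklore] -/
theorem exists_norm_le_of_continuousOn {F W : Type*} [TopologicalSpace F]
    [NormedAddCommGroup W] {O D : Set F} {θ : F → W} (hθ : ContinuousOn θ O) (hD : D ⊆ O)
    (hDc : IsCompact D) : ∃ M : ℝ, ∀ V ∈ D, ‖θ V‖ ≤ M :=
  hDc.exists_bound_of_continuousOn (hθ.mono hD)

/-- **McShane extension of `θ ∘ Ū` from a box.** If `Ū` is Lipschitz on the box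
`[0,T'] × B̄(0,R)` with values in `D` and `θ` is Lipschitz on `D`, there is a globally Lipschitz
`Θ : ℝ × ℝ^m → ℝ` with `Θ = θ ∘ Ū` on the box. [folklore] -/
theorem exists_lipschitz_extension
    {Ubar : ℝ → EuclideanSpace ℝ (Fin m) → EuclideanSpace ℝ (Fin n)} {T' R : ℝ} {K : ℝ≥0}
    (hK : LipschitzOnWith K (Function.uncurry Ubar) (Icc 0 T' ×ˢ closedBall 0 R))
    {D : Set (EuclideanSpace ℝ (Fin n))}
    (hUD : ∀ p ∈ Icc 0 T' ×ˢ closedBall (0 : EuclideanSpace ℝ (Fin m)) R,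
      Function.uncurry Ubar p ∈ D)
    {θ : EuclideanSpace ℝ (Fin n) → ℝ} {L : ℝ≥0} (hθ : LipschitzOnWith L θ D) :
    ∃ Θ : ℝ × EuclideanSpace ℝ (Fin m) → ℝ, ∃ KΘ : ℝ≥0, LipschitzWith KΘ Θ ∧
      ∀ p ∈ Icc 0 T' ×ˢ closedBall (0 : EuclideanSpace ℝ (Fin m)) R,
        Θ p = θ (Function.uncurry Ubar p) := by
  have h1 : LipschitzOnWith (L * K) (θ ∘ Function.uncurry Ubar) (Icc 0 T' ×ˢ closedBall 0 R) :=
    hθ.comp hK (fun p hp => hUD p hp)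
  obtain ⟨Θ, hΘ, hEq⟩ := h1.extend_real
  exact ⟨Θ, L * K, hΘ, fun p hp => (hEq hp).symm⟩

/-! ## Rademacher on the box and the chain rule for extensions -/

/-- **Rademacher on the box.** A function Lipschitz on `[0,T'] × B̄(0,R)` is differentiable at
a.e. point of the open box `(0,T') × B(0,R)`. [folklore] -/
theorem ae_differentiableAt_uncurry
    {Ubar : ℝ → EuclideanSpace ℝ (Fin m) → EuclideanSpace ℝ (Fin n)} {T' R : ℝ} {K : ℝ≥0}
    (hK : LipschitzOnWith K (Function.uncurry Ubar) (Icc 0 T' ×ˢ closedBall 0 R)) :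
    ∀ᵐ p ∂(volume : Measure (ℝ × EuclideanSpace ℝ (Fin m))),
      p ∈ Ioo 0 T' ×ˢ ball (0 : EuclideanSpace ℝ (Fin m)) R →
        DifferentiableAt ℝ (Function.uncurry Ubar) p := by
  haveI : (volume : Measure (ℝ × EuclideanSpace ℝ (Fin m))).IsAddHaarMeasure :=
    Measure.prod.instIsAddHaarMeasure _ _
  filter_upwards [hK.ae_differentiableWithinAt_of_mem (μ := volume)] with p hp hpo
  have hpc : p ∈ Icc 0 T' ×ˢ closedBall (0 : EuclideanSpace ℝ (Fin m)) R :=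
    ⟨Ioo_subset_Icc_self hpo.1, ball_subset_closedBall hpo.2⟩
  refine (hp hpc).differentiableAt (Filter.mem_of_superset ?_
    (Set.prod_mono Ioo_subset_Icc_self ball_subset_closedBall))
  exact (isOpen_Ioo.prod isOpen_ball).mem_nhds hpo

/-- **Chain rule for the extension.** If `Θ = θ ∘ Ū` on the box, then at a point of the open box
where `Ū` and `θ` are differentiable, `Θ` has derivative `Dθ(Ū p) ∘ DŪ(p)`. [folklore] -/
theorem hasFDerivAt_extension
    {Ubar : ℝ → EuclideanSpace ℝ (Fin m) → EuclideanSpace ℝ (Fin n)} {T' R : ℝ}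
    {Θ : ℝ × EuclideanSpace ℝ (Fin m) → ℝ} {θ : EuclideanSpace ℝ (Fin n) → ℝ}
    (hΘ : ∀ p ∈ Icc 0 T' ×ˢ closedBall (0 : EuclideanSpace ℝ (Fin m)) R,
      Θ p = θ (Function.uncurry Ubar p))
    {p : ℝ × EuclideanSpace ℝ (Fin m)} (hp : p ∈ Ioo 0 T' ×ˢ ball (0 : EuclideanSpace ℝ (Fin m)) R)
    (hU : DifferentiableAt ℝ (Function.uncurry Ubar) p)
    (hθ : DifferentiableAt ℝ θ (Function.uncurry Ubar p)) :
    HasFDerivAt Θ ((fderiv ℝ θ (Function.uncurry Ubar p)).comp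
      (fderiv ℝ (Function.uncurry Ubar) p)) p := by
  have h1 : HasFDerivAt (θ ∘ Function.uncurry Ubar) ((fderiv ℝ θ (Function.uncurry Ubar p)).comp
      (fderiv ℝ (Function.uncurry Ubar) p)) p := hθ.hasFDerivAt.comp p hU.hasFDerivAt
  refine h1.congr_of_eventuallyEq ?_
  filter_upwards [(isOpen_Ioo.prod isOpen_ball).mem_nhds hp] with q hq
  exact hΘ q ⟨Ioo_subset_Icc_self hq.1, ball_subset_closedBall hq.2⟩

/-! ## Integration by parts: a `C¹` compactly supported factor against a Lipschitz factor -/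

/-- `∫ Dφ(p)v f(p) dp = -∫ ∂ᵥf(p) φ(p) dp` for `φ ∈ C¹_c` and `f` Lipschitz (Mathlib's Lipschitz
integration by parts). [folklore] -/
theorem integral_fderiv_apply_mul_of_lipschitz {V : Type*} [NormedAddCommGroup V]
    [NormedSpace ℝ V] [FiniteDimensional ℝ V] [MeasurableSpace V] [BorelSpace V]
    {μ : Measure V} [μ.IsAddHaarMeasure] {φ f : V → ℝ} (hφ : ContDiff ℝ 1 φ)
    (hφc : HasCompactSupport φ) {K : ℝ≥0} (hf : LipschitzWith K f) (v : V) :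
    ∫ p, fderiv ℝ φ p v * f p ∂μ = -∫ p, lineDeriv ℝ f p v * φ p ∂μ := by
  obtain ⟨D, hD⟩ := hφ.lipschitzWith_of_hasCompactSupport hφc one_ne_zero
  have key := hf.integral_lineDeriv_mul_eq (μ := μ) hD hφc (-v)
  simp only [neg_neg] at key
  have h1 : ∀ p, lineDeriv ℝ φ p v = fderiv ℝ φ p v := fun p =>
    ((hφ.differentiable one_ne_zero) p).lineDeriv_eq_fderiv
  simp_rw [h1, lineDeriv_neg] at key
  rw [← key]
  simp only [neg_mul, integral_neg]

/-! ## The system holds almost everywhere for a classical solution -/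

/-- **A classical solution satisfies the system almost everywhere (Dafermos §4.1, p. 110).** Let
`Ū` be a weak solution on `[0,T)` (tree definition) with values in a compact `D ⊆ O`, `G_α ∈ C¹(O)`,
and Lipschitz on the box `[0,T'] × B̄(0,R)`, `0 < T' < T`. Then for a.e. `p` in the open box, `Ū`
is differentiable at `p` and `∂ₜŪ(p) + ∑_α DG_α(Ū(p)) ∂_αŪ(p) = 0`.
[cite: Dafermos2000, §4.1 p. 110] -/
theorem classical_ae_pde {O : Set (EuclideanSpace ℝ (Fin n))} (hO : IsOpen O)
    {G : Fin m → EuclideanSpace ℝ (Fin n) → EuclideanSpace ℝ (Fin n)}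
    (hG : ∀ α, ContDiffOn ℝ 1 (G α) O)
    {D : Set (EuclideanSpace ℝ (Fin n))} (hD : D ⊆ O) (hDc : IsCompact D) (hDconv : Convex ℝ D)
    {T : ℝ} {Ubar : ℝ → EuclideanSpace ℝ (Fin m) → EuclideanSpace ℝ (Fin n)}
    (hUw : IsWeakSolution O G T Ubar (Ubar 0)) (hUD : ∀ t ∈ Ico 0 T, ∀ x, Ubar t x ∈ D)
    {T' R : ℝ} (hT' : T' < T) {K : ℝ≥0}
    (hK : LipschitzOnWith K (Function.uncurry Ubar) (Icc 0 T' ×ˢ closedBall 0 R)) :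
    ∀ᵐ p ∂(volume : Measure (ℝ × EuclideanSpace ℝ (Fin m))),
      p ∈ Ioo 0 T' ×ˢ ball (0 : EuclideanSpace ℝ (Fin m)) R →
        DifferentiableAt ℝ (Function.uncurry Ubar) p ∧
        fderiv ℝ (Function.uncurry Ubar) p (1, 0)
          + ∑ α : Fin m, fderiv ℝ (G α) (Function.uncurry Ubar p)
              (fderiv ℝ (Function.uncurry Ubar) p (0, EuclideanSpace.single α (1 : ℝ))) = 0 := by
  classical
  haveI : (volume : Measure (ℝ × EuclideanSpace ℝ (Fin m))).IsAddHaarMeasure :=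
    Measure.prod.instIsAddHaarMeasure _ _
  have hUnc : ∀ p : ℝ × EuclideanSpace ℝ (Fin m), Function.uncurry Ubar p = Ubar p.1 p.2 :=
    fun p => rfl
  -- notation
  set Bc : Set (ℝ × EuclideanSpace ℝ (Fin m)) := Icc 0 T' ×ˢ closedBall 0 R with hBc
  set Bo : Set (ℝ × EuclideanSpace ℝ (Fin m)) := Ioo 0 T' ×ˢ ball 0 R with hBo
  set e₀ : ℝ × EuclideanSpace ℝ (Fin m) := (1, 0) with he₀
  set e : Fin m → ℝ × EuclideanSpace ℝ (Fin m) :=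
    fun α => (0, EuclideanSpace.single α (1 : ℝ)) with he
  have hBo_open : IsOpen Bo := isOpen_Ioo.prod isOpen_ball
  have hBoBc : Bo ⊆ Bc := Set.prod_mono Ioo_subset_Icc_self ball_subset_closedBall
  have hBc_slab : ∀ p ∈ Bc, p.1 ∈ Ico 0 T := fun p hp =>
    ⟨hp.1.1, lt_of_le_of_lt hp.1.2 hT'⟩
  have hBcD : ∀ p ∈ Bc, Function.uncurry Ubar p ∈ D := fun p hp => hUD p.1 (hBc_slab p hp) p.2
  have hBo_slab : Bo ⊆ Ioo 0 T ×ˢ univ := fun p hp =>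
    ⟨⟨hp.1.1, lt_trans hp.1.2 hT'⟩, mem_univ _⟩
  -- Lipschitz constants on `D` for the coordinates and for the coordinates of `G_α`
  have hcoordL : ∀ i : Fin n, LipschitzOnWith ‖(EuclideanSpace.proj i : EuclideanSpace ℝ (Fin n)
      →L[ℝ] ℝ)‖₊ (fun V : EuclideanSpace ℝ (Fin n) => V i) D := fun i => by
    have := (EuclideanSpace.proj i : EuclideanSpace ℝ (Fin n) →L[ℝ] ℝ).lipschitz.lipschitzOnWith
      (s := D)
    simpa using this
  have hGiL : ∀ α i, ∃ L : ℝ≥0, LipschitzOnWith L (fun V => (G α V) i) D := by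
    intro α i
    have h1 : ContDiffOn ℝ 1 (fun V => (G α V) i) O := by
      exact ((EuclideanSpace.proj i : EuclideanSpace ℝ (Fin n) →L[ℝ] ℝ).contDiff
        (n := 1)).comp_contDiffOn (hG α)
    exact exists_lipschitzOnWith_of_contDiffOn_convex hO h1 hD hDc hDconv
  -- global Lipschitz extensions of the coordinates of `Ū` and of `G_α(Ū)` from the box
  have hUext : ∀ i : Fin n, ∃ Θ : ℝ × EuclideanSpace ℝ (Fin m) → ℝ, ∃ KΘ : ℝ≥0,
      LipschitzWith KΘ Θ ∧ ∀ p ∈ Bc, Θ p = (Function.uncurry Ubar p) i := fun i =>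
    exists_lipschitz_extension hK hBcD (hcoordL i)
  have hGext : ∀ α i, ∃ Θ : ℝ × EuclideanSpace ℝ (Fin m) → ℝ, ∃ KΘ : ℝ≥0,
      LipschitzWith KΘ Θ ∧ ∀ p ∈ Bc, Θ p = (G α (Function.uncurry Ubar p)) i := by
    intro α i
    obtain ⟨L, hL⟩ := hGiL α i
    exact exists_lipschitz_extension hK hBcD hL
  choose Uext KU hUlip hUeq using hUext
  choose Gext KG hGlip hGeq using hGext
  -- the candidate for the `i`-th component of `∂ₜŪ + ∑ ∂_α G_α(Ū)`
  set W : Fin n → ℝ × EuclideanSpace ℝ (Fin m) → ℝ := fun i p =>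
    lineDeriv ℝ (Uext i) p e₀ + ∑ α : Fin m, lineDeriv ℝ (Gext α i) p (e α) with hW
  have hWmeas : ∀ i, AEStronglyMeasurable (W i) volume := fun i =>
    (aestronglyMeasurable_lineDeriv (hUlip i).continuous _).add
      (Finset.aestronglyMeasurable_fun_sum _ fun α _ =>
        aestronglyMeasurable_lineDeriv (hGlip α i).continuous _)
  have hWbdd : ∀ i, ∃ M, ∀ p, ‖W i p‖ ≤ M := by
    intro i
    refine ⟨KU i * ‖e₀‖ + ∑ α : Fin m, KG α i * ‖e α‖, fun p => ?_⟩
    refine (norm_add_le _ _).trans (add_le_add (norm_lineDeriv_le_of_lipschitz ℝ (hUlip i))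
      ((norm_sum_le _ _).trans (Finset.sum_le_sum fun α _ =>
        norm_lineDeriv_le_of_lipschitz ℝ (hGlip α i))))
  have hWli : ∀ i, LocallyIntegrableOn (W i) Bo volume := fun i => by
    obtain ⟨M, hM⟩ := hWbdd i
    exact (locallyIntegrable_of_norm_le (hWmeas i) hM).locallyIntegrableOn Bo
  -- data of the weak formulation of `Ū`
  obtain ⟨hUm, -, -, -, ⟨C, hUC, -⟩, hGli, hweak⟩ := hUw
  have hGbdd : ∃ MG : ℝ, ∀ α, ∀ V ∈ D, ‖G α V‖ ≤ MG := by
    have h1 : ∀ α, ∃ M : ℝ, ∀ V ∈ D, ‖G α V‖ ≤ M := fun α =>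
      exists_norm_le_of_continuousOn (hG α).continuousOn hD hDc
    choose Mα hMα using h1
    refine ⟨∑ α, |Mα α|, fun α V hV => (hMα α V hV).trans ((le_abs_self _).trans ?_)⟩
    exact Finset.single_le_sum (f := fun α => |Mα α|) (fun α _ => abs_nonneg _)
      (Finset.mem_univ α)
  obtain ⟨MG, hMG⟩ := hGbdd
  set M : ℝ := max C MG with hMdef
  have hu : AEStronglyMeasurable (fun p : ℝ × EuclideanSpace ℝ (Fin m) => Ubar p.1 p.2)
      (volume.restrict (Ioo 0 T ×ˢ univ)) := hUm.aestronglyMeasurable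
  have hg : ∀ α, AEStronglyMeasurable (fun p : ℝ × EuclideanSpace ℝ (Fin m) => G α (Ubar p.1 p.2))
      (volume.restrict (Ioo 0 T ×ˢ univ)) := fun α =>
    (hGli α).aestronglyMeasurable.mono_measure
      (Measure.restrict_mono (Set.prod_mono Ioo_subset_Ico_self le_rfl) le_rfl)
  have hslab : ∀ᵐ p ∂(volume.restrict (Ioo (0 : ℝ) T ×ˢ (univ : Set (EuclideanSpace ℝ (Fin m))))),
      p ∈ Ioo (0 : ℝ) T ×ˢ (univ : Set (EuclideanSpace ℝ (Fin m))) :=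
    ae_restrict_mem (measurableSet_Ioo.prod MeasurableSet.univ)
  have huM : ∀ᵐ p ∂(volume.restrict (Ioo 0 T ×ˢ univ)),
      ‖(fun p : ℝ × EuclideanSpace ℝ (Fin m) => Ubar p.1 p.2) p‖ ≤ M := by
    filter_upwards [hslab] with p hp
    exact (hUC p.1 (Ioo_subset_Ico_self hp.1) p.2).trans (le_max_left _ _)
  have hgM : ∀ α, ∀ᵐ p ∂(volume.restrict (Ioo 0 T ×ˢ univ)),
      ‖(fun p : ℝ × EuclideanSpace ℝ (Fin m) => G α (Ubar p.1 p.2)) p‖ ≤ M := by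
    intro α
    filter_upwards [hslab] with p hp
    exact (hMG α _ (hUD p.1 (Ioo_subset_Ico_self hp.1) p.2)).trans (le_max_right _ _)
  -- Step 1: `∫ φ W_i = 0` for every smooth `φ` supported in the open box
  have hW0 : ∀ i, ∀ᵐ p ∂volume, p ∈ Bo → W i p = 0 := by
    intro i
    refine hBo_open.ae_eq_zero_of_integral_contDiff_smul_eq_zero (hWli i) fun φ hφ hφc hφs => ?_
    have hφ1 : ContDiff ℝ 1 φ := contDiff_infty.1 hφ 1
    have hφd : Differentiable ℝ φ := hφ1.differentiable one_ne_zero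
    -- `φ` is a test function on `[0,T)` vanishing at `t = 0`
    have hφ_out : ∀ p : ℝ × EuclideanSpace ℝ (Fin m), p ∉ Bo → φ p = 0 := fun p hp =>
      image_eq_zero_of_notMem_tsupport fun h => hp (hφs h)
    have hφT : ∀ t x, T' ≤ t → φ (t, x) = 0 := fun t x ht =>
      hφ_out (t, x) fun h => not_lt.mpr ht h.1.2
    have hφ0 : ∀ x, φ (0, x) = 0 := fun x => hφ_out (0, x) fun h => lt_irrefl _ h.1.1
    have htest : IsTestFunction T φ := ⟨hφ1, hφc, T', hT', hφT⟩
    have hid := hweak φ htest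
    have hinit : ∫ x, φ (0, x) • Ubar 0 x = 0 := by simp [hφ0]
    rw [hinit, add_zero] at hid
    have key := pairing_eq_setIntegral hu hg huM hgM hφ1 hφc
    simp only at key
    rw [key] at hid
    -- `hid : ∫_{slab} [Dφ e₀ • Ū + ∑ Dφ (e α) • G α (Ū)] = 0`; take the `i`-th coordinate
    set Fv : ℝ × EuclideanSpace ℝ (Fin m) → EuclideanSpace ℝ (Fin n) := fun p =>
      fderiv ℝ φ p e₀ • Ubar p.1 p.2
        + ∑ α : Fin m, fderiv ℝ φ p (e α) • G α (Ubar p.1 p.2) with hFv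
    have hcont : ∀ v, Continuous fun p => fderiv ℝ φ p v := fun v =>
      (hφ1.continuous_fderiv one_ne_zero).clm_apply continuous_const
    have hcs : ∀ v, HasCompactSupport fun p => fderiv ℝ φ p v := fun v =>
      hφc.fderiv_apply (𝕜 := ℝ) v
    have hFvi : Integrable Fv (volume.restrict (Ioo 0 T ×ˢ univ)) := by
      refine Integrable.add ?_ (integrable_finsetSum _ fun α _ => ?_)
      · exact integrable_smul_of_norm_le (hcont _) (hcs _) hu huM
      · exact integrable_smul_of_norm_le (hcont _) (hcs _) (hg α) (hgM α)
    have hcoord : ∫ p in Ioo 0 T ×ˢ univ, (fderiv ℝ φ p e₀ * (Function.uncurry Ubar p) i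
        + ∑ α : Fin m, fderiv ℝ φ p (e α) * (G α (Function.uncurry Ubar p)) i) = 0 := by
      have h1 := (EuclideanSpace.proj i : EuclideanSpace ℝ (Fin n) →L[ℝ] ℝ).integral_comp_comm hFvi
      rw [show (∫ p in Ioo 0 T ×ˢ univ, Fv p) = 0 from hid, map_zero] at h1
      calc ∫ p in Ioo 0 T ×ˢ univ, (fderiv ℝ φ p e₀ * (Function.uncurry Ubar p) i
            + ∑ α : Fin m, fderiv ℝ φ p (e α) * (G α (Function.uncurry Ubar p)) i)
          = ∫ p in Ioo 0 T ×ˢ univ,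
              (EuclideanSpace.proj i : EuclideanSpace ℝ (Fin n) →L[ℝ] ℝ) (Fv p) := by
            refine integral_congr_ae (ae_of_all _ fun p => ?_)
            simp [hFv, hUnc, Finset.sum_apply]
        _ = 0 := h1
    -- pass to the whole space and to the extensions
    set f : ℝ × EuclideanSpace ℝ (Fin m) → ℝ := fun p =>
      fderiv ℝ φ p e₀ * Uext i p + ∑ α : Fin m, fderiv ℝ φ p (e α) * Gext α i p with hf
    have hptw : ∀ p, fderiv ℝ φ p e₀ * (Function.uncurry Ubar p) i + ∑ α : Fin m, fderiv ℝ φ p (e α) * (G α (Function.uncurry Ubar p)) i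
        = f p := by
      intro p
      by_cases hp : p ∈ tsupport φ
      · have hpc : p ∈ Bc := hBoBc (hφs hp)
        simp only [hf, hUeq i p hpc, hGeq _ i p hpc]
      · simp only [hf, fderiv_eq_zero_of_notMem_tsupport hp, zero_apply, zero_mul,
          Finset.sum_const_zero, add_zero]
    have hfslab : ∫ p in Ioo 0 T ×ˢ univ, f p = ∫ p, f p := by
      refine setIntegral_eq_integral_of_forall_compl_eq_zero fun p hp => ?_
      have hp' : p ∉ tsupport φ := fun h => hp (hBo_slab (hφs h))
      simp only [hf, fderiv_eq_zero_of_notMem_tsupport hp', zero_apply, zero_mul,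
        Finset.sum_const_zero, add_zero]
    have hf0 : ∫ p, f p = 0 := by
      rw [← hfslab]
      calc ∫ p in Ioo 0 T ×ˢ univ, f p
          = ∫ p in Ioo 0 T ×ˢ univ, (fderiv ℝ φ p e₀ * (Function.uncurry Ubar p) i
              + ∑ α : Fin m, fderiv ℝ φ p (e α) * (G α (Function.uncurry Ubar p)) i) :=
            integral_congr_ae (ae_of_all _ fun p => (hptw p).symm)
        _ = 0 := hcoord
    -- integrate by parts term by term
    have hi1 : ∀ (g : ℝ × EuclideanSpace ℝ (Fin m) → ℝ) (Kg : ℝ≥0) (v : ℝ × EuclideanSpace ℝ (Fin m)),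
        LipschitzWith Kg g → Integrable (fun p => fderiv ℝ φ p v * g p) := fun g Kg v hg' =>
      ((hcont v).mul hg'.continuous).integrable_of_hasCompactSupport (hcs v).mul_right
    have hi2 : ∀ (g : ℝ × EuclideanSpace ℝ (Fin m) → ℝ) (Kg : ℝ≥0) (v : ℝ × EuclideanSpace ℝ (Fin m)),
        LipschitzWith Kg g → Integrable (fun p => lineDeriv ℝ g p v * φ p) := by
      intro g Kg v hg'
      have := integrable_smul_of_norm_le (μ := (volume : Measure (ℝ × EuclideanSpace ℝ (Fin m))))
        hφ1.continuous hφc (aestronglyMeasurable_lineDeriv hg'.continuous _)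
        (M := Kg * ‖v‖) (ae_of_all _ fun p => norm_lineDeriv_le_of_lipschitz ℝ hg')
      simp only [smul_eq_mul] at this
      simpa only [mul_comm] using this
    have hexp : ∫ p, f p = -∫ p, W i p * φ p := by
      simp only [hf, hW]
      rw [integral_add (hi1 _ _ _ (hUlip i)) (integrable_finsetSum _ fun α _ => hi1 _ _ _ (hGlip α i)),
        integral_finsetSum _ fun α _ => hi1 _ _ _ (hGlip α i),
        integral_fderiv_apply_mul_of_lipschitz hφ1 hφc (hUlip i)]
      simp_rw [integral_fderiv_apply_mul_of_lipschitz hφ1 hφc (hGlip _ i)]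
      have h2 : ∀ p, (lineDeriv ℝ (Uext i) p e₀ + ∑ α : Fin m, lineDeriv ℝ (Gext α i) p (e α)) * φ p
          = lineDeriv ℝ (Uext i) p e₀ * φ p + ∑ α : Fin m, lineDeriv ℝ (Gext α i) p (e α) * φ p := by
        intro p; rw [add_mul, Finset.sum_mul]
      simp_rw [h2]
      rw [integral_add (hi2 _ _ _ (hUlip i)) (integrable_finsetSum _ fun α _ => hi2 _ _ _ (hGlip α i)),
        integral_finsetSum _ fun α _ => hi2 _ _ _ (hGlip α i), Finset.sum_neg_distrib, neg_add]
    have : ∫ p, W i p * φ p = 0 := by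
      have h := hf0; rw [hexp] at h; simpa using h
    rw [← this]
    refine integral_congr_ae (ae_of_all _ fun p => ?_)
    simp only [smul_eq_mul, mul_comm]
  -- Step 2: at a.e. point of the open box, identify `W_i` with the `i`-th component of the system
  have hGdiff : ∀ α, ∀ V ∈ D, DifferentiableAt ℝ (G α) V := fun α V hV =>
    ((hG α).differentiableOn one_ne_zero V (hD hV)).differentiableAt (hO.mem_nhds (hD hV))
  filter_upwards [ae_differentiableAt_uncurry hK, ae_all_iff.2 hW0] with p hdiff hWp hp
  have hd : DifferentiableAt ℝ (Function.uncurry Ubar) p := hdiff hp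
  refine ⟨hd, ?_⟩
  have hpD : Function.uncurry Ubar p ∈ D := hBcD p (hBoBc hp)
  -- line derivatives of the extensions at `p`
  have hU_line : ∀ i v, lineDeriv ℝ (Uext i) p v = (fderiv ℝ (Function.uncurry Ubar) p v) i := by
    intro i v
    have hθ : DifferentiableAt ℝ (fun V : EuclideanSpace ℝ (Fin n) => V i) (Function.uncurry Ubar p) :=
      (EuclideanSpace.proj i : EuclideanSpace ℝ (Fin n) →L[ℝ] ℝ).differentiableAt
    have h1 := hasFDerivAt_extension (θ := fun V : EuclideanSpace ℝ (Fin n) => V i)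
      (hUeq i) hp hd hθ
    rw [(h1.hasLineDerivAt v).lineDeriv]
    have h2 : fderiv ℝ (fun V : EuclideanSpace ℝ (Fin n) => V i) (Function.uncurry Ubar p)
        = (EuclideanSpace.proj i : EuclideanSpace ℝ (Fin n) →L[ℝ] ℝ) :=
      (EuclideanSpace.proj i : EuclideanSpace ℝ (Fin n) →L[ℝ] ℝ).fderiv
    rw [ContinuousLinearMap.comp_apply, h2]
    simp
  have hG_line : ∀ α i v, lineDeriv ℝ (Gext α i) p v = (fderiv ℝ (G α) (Function.uncurry Ubar p) (fderiv ℝ (Function.uncurry Ubar) p v)) i := by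
    intro α i v
    have hθ' : HasFDerivAt (fun V : EuclideanSpace ℝ (Fin n) => (G α V) i)
        ((EuclideanSpace.proj i : EuclideanSpace ℝ (Fin n) →L[ℝ] ℝ).comp (fderiv ℝ (G α) (Function.uncurry Ubar p)))
        (Function.uncurry Ubar p) :=
      (EuclideanSpace.proj i : EuclideanSpace ℝ (Fin n) →L[ℝ] ℝ).hasFDerivAt.comp _
        (hGdiff α _ hpD).hasFDerivAt
    have h1 := hasFDerivAt_extension (θ := fun V : EuclideanSpace ℝ (Fin n) => (G α V) i)
      (hGeq α i) hp hd hθ'.differentiableAt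
    rw [(h1.hasLineDerivAt v).lineDeriv, hθ'.fderiv]
    simp
  ext i
  have h := hWp i hp
  simp only [hW, hU_line, hG_line] at h
  simpa [Finset.sum_apply] using h

/-! ## The entropy equality for a classical solution -/

/-- **A classical solution satisfies the entropy equality (4.3.4) with `=` (Dafermos §4.3,
p. 113).** With the notation of `classical_ae_pde`, let `(η, q)` be a `C¹` entropy–entropy-flux
pair on `O` (`Dq_α = Dη DG_α`, (4.3.1)). Then for every `C¹` test function `ψ` with compact
support contained in `(-∞,T') × B(0,R)`, `0 < T' < T`,
`∫_{(0,T)×ℝ^m} [Dψ(1,0) η(Ū) + ∑_α Dψ(0,e_α) q_α(Ū)] + ∫ ψ(0,x) η(Ū(0,x)) dx = 0`.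
[cite: Dafermos2000, §4.3 p. 113] -/
theorem classical_entropy_eq {O : Set (EuclideanSpace ℝ (Fin n))} (hO : IsOpen O)
    {G : Fin m → EuclideanSpace ℝ (Fin n) → EuclideanSpace ℝ (Fin n)}
    (hG : ∀ α, ContDiffOn ℝ 1 (G α) O)
    {η : EuclideanSpace ℝ (Fin n) → ℝ} {q : Fin m → EuclideanSpace ℝ (Fin n) → ℝ}
    (hη : ContDiffOn ℝ 1 η O) (hq : ∀ α, ContDiffOn ℝ 1 (q α) O)
    (hcompat : ∀ V ∈ O, ∀ α, fderiv ℝ (q α) V = (fderiv ℝ η V).comp (fderiv ℝ (G α) V))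
    {D : Set (EuclideanSpace ℝ (Fin n))} (hD : D ⊆ O) (hDc : IsCompact D) (hDconv : Convex ℝ D)
    {T : ℝ} {Ubar : ℝ → EuclideanSpace ℝ (Fin m) → EuclideanSpace ℝ (Fin n)}
    (hUw : IsWeakSolution O G T Ubar (Ubar 0)) (hUD : ∀ t ∈ Ico 0 T, ∀ x, Ubar t x ∈ D)
    {T' R : ℝ} (hT'0 : 0 < T') (hT' : T' < T) {K : ℝ≥0}
    (hK : LipschitzOnWith K (Function.uncurry Ubar) (Icc 0 T' ×ˢ closedBall 0 R))
    {ψ : ℝ × EuclideanSpace ℝ (Fin m) → ℝ} (hψ : ContDiff ℝ 1 ψ) (hψc : HasCompactSupport ψ)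
    (hψs : tsupport ψ ⊆ Iio T' ×ˢ ball (0 : EuclideanSpace ℝ (Fin m)) R) :
    (∫ p in Ioo 0 T ×ˢ univ, (fderiv ℝ ψ p (1, 0) * η (Ubar p.1 p.2)
        + ∑ α : Fin m, fderiv ℝ ψ p (0, EuclideanSpace.single α (1 : ℝ)) * q α (Ubar p.1 p.2)))
      + ∫ x, ψ (0, x) * η (Ubar 0 x) = 0 := by
  classical
  haveI : (volume : Measure (ℝ × EuclideanSpace ℝ (Fin m))).IsAddHaarMeasure :=
    Measure.prod.instIsAddHaarMeasure _ _
  set Bc : Set (ℝ × EuclideanSpace ℝ (Fin m)) := Icc 0 T' ×ˢ closedBall 0 R with hBc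
  set Bo : Set (ℝ × EuclideanSpace ℝ (Fin m)) := Ioo 0 T' ×ˢ ball 0 R with hBo
  set e₀ : ℝ × EuclideanSpace ℝ (Fin m) := (1, 0) with he₀
  set e : Fin m → ℝ × EuclideanSpace ℝ (Fin m) :=
    fun α => (0, EuclideanSpace.single α (1 : ℝ)) with he
  have hBoBc : Bo ⊆ Bc := Set.prod_mono Ioo_subset_Icc_self ball_subset_closedBall
  have hBcD : ∀ p ∈ Bc, Function.uncurry Ubar p ∈ D := fun p hp =>
    hUD p.1 ⟨hp.1.1, lt_of_le_of_lt hp.1.2 hT'⟩ p.2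
  -- support facts for `ψ`
  have hψ_out : ∀ p : ℝ × EuclideanSpace ℝ (Fin m), p ∉ Iio T' ×ˢ ball (0 : EuclideanSpace ℝ (Fin m)) R
      → ψ p = 0 := fun p hp => image_eq_zero_of_notMem_tsupport fun h => hp (hψs h)
  have hψT : ∀ t x, T' ≤ t → ψ (t, x) = 0 := fun t x ht =>
    hψ_out (t, x) fun h => not_lt.mpr ht h.1
  have hsupp_slab : ∀ p ∈ tsupport ψ, p.1 ∈ Ioo (0 : ℝ) T → p ∈ Bo := fun p hp ht =>
    ⟨⟨ht.1, (hψs hp).1⟩, (hψs hp).2⟩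
  have hsupp0 : ∀ x, ψ (0, x) ≠ 0 → ((0 : ℝ), x) ∈ Bc := by
    intro x hx
    have h := hψs (subset_tsupport _ hx)
    exact ⟨⟨le_rfl, hT'0.le⟩, ball_subset_closedBall h.2⟩
  -- Lipschitz extensions of `η ∘ Ū` and `q_α ∘ Ū`
  obtain ⟨Lη, hLη⟩ := exists_lipschitzOnWith_of_contDiffOn_convex hO hη hD hDc hDconv
  have hLq : ∀ α, ∃ L : ℝ≥0, LipschitzOnWith L (q α) D := fun α =>
    exists_lipschitzOnWith_of_contDiffOn_convex hO (hq α) hD hDc hDconv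
  obtain ⟨A, KA, hA, hAeq⟩ := exists_lipschitz_extension hK hBcD hLη
  have hBex : ∀ α, ∃ Θ : ℝ × EuclideanSpace ℝ (Fin m) → ℝ, ∃ KΘ : ℝ≥0,
      LipschitzWith KΘ Θ ∧ ∀ p ∈ Bc, Θ p = q α (Function.uncurry Ubar p) := by
    intro α
    obtain ⟨L, hL⟩ := hLq α
    exact exists_lipschitz_extension hK hBcD hL
  choose B KB hB hBeq using hBex
  -- a common Lipschitz constant for the `B α`
  have hB' : ∀ α, LipschitzWith (∑ β, KB β) (B α) := fun α =>
    (hB α).weaken (Finset.single_le_sum (f := KB) (fun _ _ => bot_le) (Finset.mem_univ α))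
  -- the slab integration by parts
  have hibp := ibp_slab hT'0 hT'.le hA hB' hψ hψc hψT
  -- identify the left-hand sides
  have hL1 : ∀ p : ℝ × EuclideanSpace ℝ (Fin m), p.1 ∈ Ioo (0 : ℝ) T →
      fderiv ℝ ψ p e₀ * A p + ∑ α : Fin m, fderiv ℝ ψ p (e α) * B α p
        = fderiv ℝ ψ p e₀ * η (Ubar p.1 p.2)
          + ∑ α : Fin m, fderiv ℝ ψ p (e α) * q α (Ubar p.1 p.2) := by
    intro p hp
    by_cases hps : p ∈ tsupport ψ
    · have hpc : p ∈ Bc := hBoBc (hsupp_slab p hps hp)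
      have e1 : A p = η (Ubar p.1 p.2) := hAeq p hpc
      have e2 : ∀ α, B α p = q α (Ubar p.1 p.2) := fun α => hBeq α p hpc
      simp only [e1, e2]
    · simp only [fderiv_eq_zero_of_notMem_tsupport hps, zero_apply, zero_mul,
        Finset.sum_const_zero, add_zero]
  have hL2 : ∀ x, ψ (0, x) * A (0, x) = ψ (0, x) * η (Ubar 0 x) := by
    intro x
    by_cases hx : ψ (0, x) = 0
    · simp [hx]
    · have e1 : A (0, x) = η (Ubar 0 x) := hAeq _ (hsupp0 x hx)
      rw [e1]
  have hlhs1 : ∫ p in Ioo 0 T ×ˢ univ, (fderiv ℝ ψ p e₀ * A p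
      + ∑ α : Fin m, fderiv ℝ ψ p (e α) * B α p)
      = ∫ p in Ioo 0 T ×ˢ univ, (fderiv ℝ ψ p e₀ * η (Ubar p.1 p.2)
          + ∑ α : Fin m, fderiv ℝ ψ p (e α) * q α (Ubar p.1 p.2)) := by
    refine setIntegral_congr_fun (measurableSet_Ioo.prod MeasurableSet.univ) fun p hp => ?_
    exact hL1 p hp.1
  have hlhs2 : ∫ x, ψ (0, x) * A (0, x) = ∫ x, ψ (0, x) * η (Ubar 0 x) := by
    refine integral_congr_ae (ae_of_all _ fun x => hL2 x)
  -- the right-hand side vanishes: the entropy identity holds a.e. on the open box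
  have hpde := classical_ae_pde hO hG hD hDc hDconv hUw hUD hT' hK
  have hηdiff : ∀ V ∈ D, DifferentiableAt ℝ η V := fun V hV =>
    (hη.differentiableOn one_ne_zero V (hD hV)).differentiableAt (hO.mem_nhds (hD hV))
  have hqdiff : ∀ α, ∀ V ∈ D, DifferentiableAt ℝ (q α) V := fun α V hV =>
    ((hq α).differentiableOn one_ne_zero V (hD hV)).differentiableAt (hO.mem_nhds (hD hV))
  have hrhs : ∫ p in Ioo 0 T ×ˢ univ, ψ p * (fderiv ℝ A p e₀
      + ∑ α : Fin m, fderiv ℝ (B α) p (e α)) = 0 := by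
    refine setIntegral_eq_zero_of_ae_eq_zero ?_
    filter_upwards [hpde] with p hp
    intro hpslab
    by_cases hps : p ∈ tsupport ψ
    · have hpo : p ∈ Bo := hsupp_slab p hps hpslab.1
      obtain ⟨hd, hsys⟩ := hp hpo
      have hpD : Function.uncurry Ubar p ∈ D := hBcD p (hBoBc hpo)
      have hAd := hasFDerivAt_extension (θ := η) hAeq hpo hd (hηdiff _ hpD)
      have hBd : ∀ α, HasFDerivAt (B α) ((fderiv ℝ (q α) (Function.uncurry Ubar p)).comp (fderiv ℝ (Function.uncurry Ubar) p)) p :=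
        fun α => hasFDerivAt_extension (θ := q α) (hBeq α) hpo hd (hqdiff α _ hpD)
      have hB_fd : ∀ α, fderiv ℝ (B α) p = (fderiv ℝ (q α) (Function.uncurry Ubar p)).comp (fderiv ℝ (Function.uncurry Ubar) p) :=
        fun α => (hBd α).fderiv
      have hq_fd : ∀ α, fderiv ℝ (q α) (Function.uncurry Ubar p) = (fderiv ℝ η (Function.uncurry Ubar p)).comp (fderiv ℝ (G α) (Function.uncurry Ubar p)) :=
        fun α => hcompat _ (hD hpD) α
      have hsum : fderiv ℝ A p e₀ + ∑ α : Fin m, fderiv ℝ (B α) p (e α)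
          = fderiv ℝ η (Function.uncurry Ubar p) (fderiv ℝ (Function.uncurry Ubar) p e₀
              + ∑ α : Fin m, fderiv ℝ (G α) (Function.uncurry Ubar p) (fderiv ℝ (Function.uncurry Ubar) p (e α))) := by
        simp only [hAd.fderiv, hB_fd, hq_fd, ContinuousLinearMap.comp_apply, map_add, map_sum]
      rw [hsum, hsys, map_zero, mul_zero]
    · simp [image_eq_zero_of_notMem_tsupport hps]
  rw [hlhs1, hlhs2, hrhs, neg_zero] at hibp
  exact hibp

end Literature.Analysis.PDE.ConservationLaw

/-!
# Relative entropy: pointwise Taylor bounds on a convex compact set, and the symmetry (4.3.2)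

Topic `Literature/Analysis/PDE`. Fifth layer of the formalization of Dafermos' weak–strong
uniqueness theorem (`Literature.Analysis.PDE.ConservationLaw.dafermos_weak_strong_uniqueness`,
Dafermos 2000, Thm 5.2.1). Pointwise ingredients of the proof (pp. 126–128): with
`h(U,Ū) = η(U) - η(Ū) - Dη(Ū)[U - Ū]` (5.2.2), `f_α(U,Ū) = q_α(U) - q_α(Ū) - Dη(Ū)[G_α(U) - G_α(Ū)]`
(5.2.3), `Z_α(U,Ū) = G_α(U) - G_α(Ū) - DG_α(Ū)[U - Ū]` (5.2.4), "all of quadratic order in `U - Ū`",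
and "`h(U,Ū)` is positive definite, due to the convexity of `η`" (p. 128), on a convex compact
`𝒟 ⊆ 𝒪`:

* `relEntropy_lower` — `c ‖U - Ū‖² ≤ h(U,Ū)` (uniform convexity of `η` on `𝒟`);
* `fluxDefect_le` — `|f_α(U,Ū)| ≤ C ‖U - Ū‖²` (uses (4.3.1) `Dq_α = Dη DG_α`);
* `taylorDefect_le` — `‖Z_α(U,Ū)‖ ≤ C ‖U - Ū‖²`;
* `fderiv_fderiv_apply_fderiv_symm` — the symmetry (4.3.2)
  `D²η(U)[a, DG_α(U) b] = D²η(U)[b, DG_α(U) a]`, obtained from (4.3.1) by differentiation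
  (Dafermos §3.2 / (4.3.2), p. 113), together with bounds on `Dη`, `D²η`, `DG_α` over `𝒟`.

All proofs are one-variable calculus along the segment `Ū + s(U - Ū) ⊆ 𝒟`. [folklore]

## References

* C. M. Dafermos, *Hyperbolic Conservation Laws in Continuum Physics*, Springer 2000, §4.3
  (4.3.1)–(4.3.2), §5.2 (5.2.2)–(5.2.5) [Dafermos2000].
-/


open MeasureTheory Set Filter Metric ContinuousLinearMap
open scoped Topology NNReal BigOperators

namespace Literature.Analysis.PDE.ConservationLaw

variable {n : ℕ}

section Pointwise

variable {F : Type*} [NormedAddCommGroup F] [NormedSpace ℝ F]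
  {W' : Type*} [NormedAddCommGroup W'] [NormedSpace ℝ W']
  {O D : Set F}

/-! ## Uniform bounds over `D` -/

/-- Bound on the derivative of a `C¹` function over a compact `D ⊆ O`. [folklore] -/
theorem exists_forall_norm_fderiv_le (hO : IsOpen O) {θ : F → W'} (hθ : ContDiffOn ℝ 1 θ O)
    (hD : D ⊆ O) (hDc : IsCompact D) : ∃ M : ℝ, 0 ≤ M ∧ ∀ V ∈ D, ‖fderiv ℝ θ V‖ ≤ M := by
  obtain ⟨M, hM⟩ := hDc.exists_bound_of_continuousOn
    ((hθ.continuousOn_fderiv_of_isOpen hO le_rfl).mono hD)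
  exact ⟨max M 0, le_max_right _ _, fun V hV => (hM V hV).trans (le_max_left _ _)⟩

/-- Bound on the second derivative of a `C²` function over a compact `D ⊆ O`. [folklore] -/
theorem exists_forall_norm_fderiv_fderiv_le (hO : IsOpen O) {θ : F → W'}
    (hθ : ContDiffOn ℝ 2 θ O) (hD : D ⊆ O) (hDc : IsCompact D) :
    ∃ M : ℝ, 0 ≤ M ∧ ∀ V ∈ D, ‖fderiv ℝ (fderiv ℝ θ) V‖ ≤ M :=
  exists_forall_norm_fderiv_le hO (hθ.fderiv_of_isOpen hO le_rfl) hD hDc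

/-- The derivative of a `C²` function is Lipschitz on a convex compact `D ⊆ O`. [folklore] -/
theorem exists_lipschitzOnWith_fderiv (hO : IsOpen O) {θ : F → W'} (hθ : ContDiffOn ℝ 2 θ O)
    (hD : D ⊆ O) (hDc : IsCompact D) (hDconv : Convex ℝ D) :
    ∃ L : ℝ≥0, LipschitzOnWith L (fderiv ℝ θ) D :=
  exists_lipschitzOnWith_of_contDiffOn_convex hO (hθ.fderiv_of_isOpen hO le_rfl) hD hDc hDconv

/-- `C²` functions on an open set: differentiability of the function and of its derivative at
points of the set. [folklore] -/
theorem differentiableAt_of_contDiffOn_two (hO : IsOpen O) {θ : F → W'}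
    (hθ : ContDiffOn ℝ 2 θ O) {V : F} (hV : V ∈ O) :
    DifferentiableAt ℝ θ V ∧ DifferentiableAt ℝ (fderiv ℝ θ) V :=
  ⟨(hθ.differentiableOn two_ne_zero V hV).differentiableAt (hO.mem_nhds hV),
    ((hθ.fderiv_of_isOpen hO le_rfl).differentiableOn one_ne_zero V hV).differentiableAt
      (hO.mem_nhds hV)⟩

/-! ## The segment `Ū + s (U - Ū)` -/

/-- Derivative of the segment parametrisation. [folklore] -/
theorem hasDerivAt_segment (W ξ : F) (s : ℝ) :
    HasDerivAt (fun s : ℝ => W + s • ξ) ξ s := by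
  simpa using ((hasDerivAt_id s).smul_const ξ).const_add W

/-! ## Lower bound on the relative entropy (positive definiteness of `h`) -/

/-- **`h(U,Ū) ≥ (c/2) ‖U - Ū‖²` on `D`.** If `η ∈ C²(O)` and `D²η(V)[ξ,ξ] ≥ c‖ξ‖²` for `V` in the
convex set `D ⊆ O`, then `η(U) - η(Ū) - Dη(Ū)[U - Ū] ≥ (c/2)‖U - Ū‖²` for `U, Ū ∈ D`
(Dafermos, p. 128: "`h(U,Ū)` is positive definite, due to the convexity of `η`"). [folklore] -/
theorem relEntropy_lower (hO : IsOpen O) {η : F → ℝ} (hη : ContDiffOn ℝ 2 η O) (hD : D ⊆ O)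
    (hDconv : Convex ℝ D) {c : ℝ}
    (hconv : ∀ V ∈ D, ∀ ξ : F, c * ‖ξ‖ ^ 2 ≤ fderiv ℝ (fderiv ℝ η) V ξ ξ)
    {V W : F} (hV : V ∈ D) (hW : W ∈ D) :
    c / 2 * ‖V - W‖ ^ 2 ≤ η V - η W - fderiv ℝ η W (V - W) := by
  set ξ : F := V - W with hξ
  set γ : ℝ → F := fun s => W + s • ξ with hγ
  have hγD : ∀ s ∈ Icc (0 : ℝ) 1, γ s ∈ D := fun s hs => hDconv.add_smul_sub_mem hW hV hs
  have hγd : ∀ s, HasDerivAt γ ξ s := fun s => hasDerivAt_segment W ξ s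
  -- first and second derivatives along the segment
  set φ : ℝ → ℝ := fun s => η (γ s) with hφ
  set φ' : ℝ → ℝ := fun s => fderiv ℝ η (γ s) ξ with hφ'
  set φ'' : ℝ → ℝ := fun s => fderiv ℝ (fderiv ℝ η) (γ s) ξ ξ with hφ''
  have hφd : ∀ s ∈ Icc (0 : ℝ) 1, HasDerivAt φ (φ' s) s := fun s hs =>
    (differentiableAt_of_contDiffOn_two hO hη (hD (hγD s hs))).1.hasFDerivAt.comp_hasDerivAt s
      (hγd s)
  have hφ'd : ∀ s ∈ Icc (0 : ℝ) 1, HasDerivAt φ' (φ'' s) s := by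
    intro s hs
    have hc : HasDerivAt (fun s => fderiv ℝ η (γ s)) (fderiv ℝ (fderiv ℝ η) (γ s) ξ) s :=
      (differentiableAt_of_contDiffOn_two hO hη (hD (hγD s hs))).2.hasFDerivAt.comp_hasDerivAt s
        (hγd s)
    have := hc.clm_apply (hasDerivAt_const s ξ)
    simpa [hφ', hφ''] using this
  -- the auxiliary function `k` and its derivative `k'`
  set k : ℝ → ℝ := fun s => φ s - φ 0 - s * φ' 0 - c / 2 * s ^ 2 * ‖ξ‖ ^ 2 with hk
  set k' : ℝ → ℝ := fun s => φ' s - φ' 0 - c * s * ‖ξ‖ ^ 2 with hk'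
  have hkd : ∀ s ∈ Icc (0 : ℝ) 1, HasDerivAt k (k' s) s := by
    intro s hs
    have h1 : HasDerivAt (fun s : ℝ => s * φ' 0) (1 * φ' 0) s := (hasDerivAt_id s).mul_const _
    have h2 : HasDerivAt (fun s : ℝ => c / 2 * s ^ 2 * ‖ξ‖ ^ 2) (c / 2 * (2 * s) * ‖ξ‖ ^ 2) s := by
      have := ((hasDerivAt_pow 2 s).const_mul (c / 2)).mul_const (‖ξ‖ ^ 2)
      simpa using this
    have := (((hφd s hs).sub_const (φ 0)).sub h1).sub h2
    refine this.congr_deriv ?_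
    simp only [hk']
    ring
  have hk'd : ∀ s ∈ Icc (0 : ℝ) 1, HasDerivAt k' (φ'' s - c * ‖ξ‖ ^ 2) s := by
    intro s hs
    have h1 : HasDerivAt (fun s : ℝ => c * s * ‖ξ‖ ^ 2) (c * 1 * ‖ξ‖ ^ 2) s :=
      ((hasDerivAt_id s).const_mul c).mul_const _
    have := ((hφ'd s hs).sub_const (φ' 0)).sub h1
    refine this.congr_deriv ?_
    ring
  -- `k'` is nondecreasing on `[0,1]`, hence nonnegative
  have hk'mono : MonotoneOn k' (Icc 0 1) := by
    refine monotoneOn_of_deriv_nonneg (convex_Icc 0 1) ?_ ?_ ?_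
    · exact fun s hs => (hk'd s hs).continuousAt.continuousWithinAt
    · rw [interior_Icc]
      exact fun s hs => (hk'd s (Ioo_subset_Icc_self hs)).differentiableAt.differentiableWithinAt
    · rw [interior_Icc]
      intro s hs
      rw [(hk'd s (Ioo_subset_Icc_self hs)).deriv]
      have := hconv (γ s) (hγD s (Ioo_subset_Icc_self hs)) ξ
      simp only [hφ'']
      linarith
  have hk'nn : ∀ s ∈ Icc (0 : ℝ) 1, 0 ≤ k' s := by
    intro s hs
    have h0 : k' 0 = 0 := by simp [hk']
    rw [← h0]
    exact hk'mono (left_mem_Icc.2 zero_le_one) hs hs.1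
  -- `k` is nondecreasing on `[0,1]`, hence `k 1 ≥ k 0 = 0`
  have hkmono : MonotoneOn k (Icc 0 1) := by
    refine monotoneOn_of_deriv_nonneg (convex_Icc 0 1) ?_ ?_ ?_
    · exact fun s hs => (hkd s hs).continuousAt.continuousWithinAt
    · rw [interior_Icc]
      exact fun s hs => (hkd s (Ioo_subset_Icc_self hs)).differentiableAt.differentiableWithinAt
    · rw [interior_Icc]
      intro s hs
      rw [(hkd s (Ioo_subset_Icc_self hs)).deriv]
      exact hk'nn s (Ioo_subset_Icc_self hs)
  have hk1 : k 0 ≤ k 1 := hkmono (left_mem_Icc.2 zero_le_one) (right_mem_Icc.2 zero_le_one)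
    zero_le_one
  have hγ1 : γ 1 = V := by simp [hγ, hξ]
  have hγ0 : γ 0 = W := by simp [hγ]
  have hk0 : k 0 = 0 := by simp [hk]
  have hk1' : k 1 = η V - η W - fderiv ℝ η W ξ - c / 2 * ‖ξ‖ ^ 2 := by
    simp only [hk, hφ, hφ', hγ1, hγ0]
    ring
  rw [hk0, hk1'] at hk1
  linarith

/-! ## Quadratic bounds on the flux defect `f_α` and on `Z_α` -/

/-- **`|f_α(U,Ū)| ≤ C ‖U - Ū‖²`.** With `η, G_α ∈ C²(O)`, `q_α ∈ C¹(O)` and (4.3.1)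
`Dq_α = Dη DG_α` on `O`: for `U, Ū` in a convex `D ⊆ O` on which `Dη` is `L`-Lipschitz and
`‖DG_α‖ ≤ M`, `|q_α(U) - q_α(Ū) - Dη(Ū)[G_α(U) - G_α(Ū)]| ≤ L M ‖U - Ū‖²`
(Dafermos (5.2.3), "of quadratic order"). [folklore] -/
theorem fluxDefect_le (hO : IsOpen O) {η : F → ℝ} {Gα : F → F} {qα : F → ℝ}
    (hη : ContDiffOn ℝ 1 η O) (hG : ContDiffOn ℝ 1 Gα O) (hq : ContDiffOn ℝ 1 qα O)
    (hcompat : ∀ V ∈ O, fderiv ℝ qα V = (fderiv ℝ η V).comp (fderiv ℝ Gα V))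
    (hD : D ⊆ O) (hDconv : Convex ℝ D)
    {L : ℝ≥0} (hL : LipschitzOnWith L (fderiv ℝ η) D) {M : ℝ} (hM : ∀ V ∈ D, ‖fderiv ℝ Gα V‖ ≤ M)
    {V W : F} (hV : V ∈ D) (hW : W ∈ D) :
    |qα V - qα W - fderiv ℝ η W (Gα V - Gα W)| ≤ L * M * ‖V - W‖ ^ 2 := by
  set ξ : F := V - W with hξ
  set γ : ℝ → F := fun s => W + s • ξ with hγ
  have hγD : ∀ s ∈ Icc (0 : ℝ) 1, γ s ∈ D := fun s hs => hDconv.add_smul_sub_mem hW hV hs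
  have hγd : ∀ s, HasDerivAt γ ξ s := fun s => hasDerivAt_segment W ξ s
  have hηd : ∀ V ∈ D, DifferentiableAt ℝ η V := fun V hV =>
    (hη.differentiableOn one_ne_zero V (hD hV)).differentiableAt (hO.mem_nhds (hD hV))
  have hGd : ∀ V ∈ D, DifferentiableAt ℝ Gα V := fun V hV =>
    (hG.differentiableOn one_ne_zero V (hD hV)).differentiableAt (hO.mem_nhds (hD hV))
  have hqd : ∀ V ∈ D, DifferentiableAt ℝ qα V := fun V hV =>
    (hq.differentiableOn one_ne_zero V (hD hV)).differentiableAt (hO.mem_nhds (hD hV))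
  set Φ : ℝ → ℝ := fun s => qα (γ s) - fderiv ℝ η W (Gα (γ s)) with hΦ
  set Φ' : ℝ → ℝ := fun s => (fderiv ℝ η (γ s) - fderiv ℝ η W) (fderiv ℝ Gα (γ s) ξ) with hΦ'
  have hΦd : ∀ s ∈ Icc (0 : ℝ) 1, HasDerivAt Φ (Φ' s) s := by
    intro s hs
    have hsD := hγD s hs
    have h1 : HasDerivAt (fun s => qα (γ s)) (fderiv ℝ qα (γ s) ξ) s :=
      (hqd _ hsD).hasFDerivAt.comp_hasDerivAt s (hγd s)
    have h2 : HasDerivAt (fun s => Gα (γ s)) (fderiv ℝ Gα (γ s) ξ) s :=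
      (hGd _ hsD).hasFDerivAt.comp_hasDerivAt s (hγd s)
    have h3 : HasDerivAt (fun s => fderiv ℝ η W (Gα (γ s))) (fderiv ℝ η W (fderiv ℝ Gα (γ s) ξ)) s :=
      (fderiv ℝ η W).hasFDerivAt.comp_hasDerivAt s h2
    have h4 := h1.sub h3
    rw [hcompat _ (hD hsD)] at h4
    refine h4.congr_deriv ?_
    simp only [hΦ', sub_apply, ContinuousLinearMap.comp_apply]
  have hbound : ∀ s ∈ Ico (0 : ℝ) 1, ‖Φ' s‖ ≤ L * M * ‖ξ‖ ^ 2 := by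
    intro s hs
    have hsD := hγD s (Ico_subset_Icc_self hs)
    have h1 : ‖fderiv ℝ η (γ s) - fderiv ℝ η W‖ ≤ L * ‖ξ‖ := by
      have := hL.norm_sub_le hsD hW
      have h2 : ‖γ s - W‖ = s * ‖ξ‖ := by
        simp only [hγ, add_sub_cancel_left, norm_smul, Real.norm_eq_abs, abs_of_nonneg hs.1]
      rw [h2] at this
      calc ‖fderiv ℝ η (γ s) - fderiv ℝ η W‖ ≤ L * (s * ‖ξ‖) := this
        _ ≤ L * (1 * ‖ξ‖) := by gcongr; exact hs.2.le
        _ = L * ‖ξ‖ := by rw [one_mul]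
    calc ‖Φ' s‖ ≤ ‖fderiv ℝ η (γ s) - fderiv ℝ η W‖ * ‖fderiv ℝ Gα (γ s) ξ‖ := le_opNorm _ _
      _ ≤ (L * ‖ξ‖) * (M * ‖ξ‖) := by
          refine mul_le_mul h1 ((le_opNorm _ _).trans (mul_le_mul_of_nonneg_right (hM _ hsD)
            (norm_nonneg _))) (norm_nonneg _) (by positivity)
      _ = L * M * ‖ξ‖ ^ 2 := by ring
  have hmvt := norm_image_sub_le_of_norm_deriv_le_segment' (fun s hs => (hΦd s hs).hasDerivWithinAt)
    hbound 1 (right_mem_Icc.2 zero_le_one)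
  have hΦ1 : Φ 1 - Φ 0 = qα V - qα W - fderiv ℝ η W (Gα V - Gα W) := by
    simp only [hΦ, hγ, hξ, one_smul, zero_smul, add_zero, add_sub_cancel, map_sub]
    ring
  rw [← Real.norm_eq_abs, ← hΦ1]
  simpa using hmvt

/-- **`‖Z_α(U,Ū)‖ ≤ C ‖U - Ū‖²`.** With `G_α ∈ C¹(O)` and `DG_α` `L`-Lipschitz on the convex
`D ⊆ O`: `‖G_α(U) - G_α(Ū) - DG_α(Ū)[U - Ū]‖ ≤ L ‖U - Ū‖²` (Dafermos (5.2.4)). [folklore] -/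
theorem taylorDefect_le (hO : IsOpen O) {Gα : F → F} (hG : ContDiffOn ℝ 1 Gα O)
    (hD : D ⊆ O) (hDconv : Convex ℝ D) {L : ℝ≥0} (hL : LipschitzOnWith L (fderiv ℝ Gα) D)
    {V W : F} (hV : V ∈ D) (hW : W ∈ D) :
    ‖Gα V - Gα W - fderiv ℝ Gα W (V - W)‖ ≤ L * ‖V - W‖ ^ 2 := by
  set ξ : F := V - W with hξ
  set γ : ℝ → F := fun s => W + s • ξ with hγ
  have hγD : ∀ s ∈ Icc (0 : ℝ) 1, γ s ∈ D := fun s hs => hDconv.add_smul_sub_mem hW hV hs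
  have hγd : ∀ s, HasDerivAt γ ξ s := fun s => hasDerivAt_segment W ξ s
  have hGd : ∀ V ∈ D, DifferentiableAt ℝ Gα V := fun V hV =>
    (hG.differentiableOn one_ne_zero V (hD hV)).differentiableAt (hO.mem_nhds (hD hV))
  set Φ : ℝ → F := fun s => Gα (γ s) - s • fderiv ℝ Gα W ξ with hΦ
  set Φ' : ℝ → F := fun s => (fderiv ℝ Gα (γ s) - fderiv ℝ Gα W) ξ with hΦ'
  have hΦd : ∀ s ∈ Icc (0 : ℝ) 1, HasDerivAt Φ (Φ' s) s := by
    intro s hs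
    have h1 : HasDerivAt (fun s => Gα (γ s)) (fderiv ℝ Gα (γ s) ξ) s :=
      (hGd _ (hγD s hs)).hasFDerivAt.comp_hasDerivAt s (hγd s)
    have h2 : HasDerivAt (fun s : ℝ => s • fderiv ℝ Gα W ξ) ((1 : ℝ) • fderiv ℝ Gα W ξ) s :=
      (hasDerivAt_id s).smul_const _
    have h3 := h1.sub h2
    refine h3.congr_deriv ?_
    simp only [hΦ', one_smul, sub_apply]
  have hbound : ∀ s ∈ Ico (0 : ℝ) 1, ‖Φ' s‖ ≤ L * ‖ξ‖ ^ 2 := by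
    intro s hs
    have hsD := hγD s (Ico_subset_Icc_self hs)
    have h1 : ‖fderiv ℝ Gα (γ s) - fderiv ℝ Gα W‖ ≤ L * ‖ξ‖ := by
      have := hL.norm_sub_le hsD hW
      have h2 : ‖γ s - W‖ = s * ‖ξ‖ := by
        simp only [hγ, add_sub_cancel_left, norm_smul, Real.norm_eq_abs, abs_of_nonneg hs.1]
      rw [h2] at this
      calc ‖fderiv ℝ Gα (γ s) - fderiv ℝ Gα W‖ ≤ L * (s * ‖ξ‖) := this
        _ ≤ L * (1 * ‖ξ‖) := by gcongr; exact hs.2.le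
        _ = L * ‖ξ‖ := by rw [one_mul]
    calc ‖Φ' s‖ ≤ ‖fderiv ℝ Gα (γ s) - fderiv ℝ Gα W‖ * ‖ξ‖ := le_opNorm _ _
      _ ≤ (L * ‖ξ‖) * ‖ξ‖ := mul_le_mul_of_nonneg_right h1 (norm_nonneg _)
      _ = L * ‖ξ‖ ^ 2 := by ring
  have hmvt := norm_image_sub_le_of_norm_deriv_le_segment' (fun s hs => (hΦd s hs).hasDerivWithinAt)
    hbound 1 (right_mem_Icc.2 zero_le_one)
  have hΦ1 : Φ 1 - Φ 0 = Gα V - Gα W - fderiv ℝ Gα W (V - W) := by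
    simp only [hΦ, hγ, hξ, one_smul, zero_smul, add_zero, add_sub_cancel, sub_zero]
    abel
  rw [← hΦ1]
  simpa using hmvt

/-! ## Symmetry of the second derivatives -/

/-- Symmetry of `D²η` at points of the open set `O` for `η ∈ C²(O)`. [folklore] -/
theorem fderiv_fderiv_symm (hO : IsOpen O) {η : F → W'} (hη : ContDiffOn ℝ 2 η O) {V : F}
    (hV : V ∈ O) (a b : F) : fderiv ℝ (fderiv ℝ η) V a b = fderiv ℝ (fderiv ℝ η) V b a := by
  have h : ContDiffAt ℝ 2 η V := hη.contDiffAt (hO.mem_nhds hV)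
  exact h.isSymmSndFDerivAt (by simp) a b

/-- **The symmetry (4.3.2).** If `η ∈ C²(O; ℝ)`, `G_α ∈ C²(O)`, `q_α ∈ C²(O; ℝ)` and (4.3.1)
`Dq_α = Dη DG_α` on the open set `O`, then `D²η(V)[a, DG_α(V) b] = D²η(V)[b, DG_α(V) a]` for
`V ∈ O` — i.e. `D²η DG_α` is symmetric (Dafermos (4.3.2), obtained by differentiating (4.3.1)).
[cite: Dafermos2000, §4.3 (4.3.2)] -/
theorem fderiv_fderiv_apply_fderiv_symm (hO : IsOpen O) {η : F → ℝ} {Gα : F → F} {qα : F → ℝ}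
    (hη : ContDiffOn ℝ 2 η O) (hG : ContDiffOn ℝ 2 Gα O) (hq : ContDiffOn ℝ 2 qα O)
    (hcompat : ∀ V ∈ O, fderiv ℝ qα V = (fderiv ℝ η V).comp (fderiv ℝ Gα V)) {V : F}
    (hV : V ∈ O) (a b : F) :
    fderiv ℝ (fderiv ℝ η) V a (fderiv ℝ Gα V b) = fderiv ℝ (fderiv ℝ η) V b (fderiv ℝ Gα V a) := by
  -- differentiate (4.3.1) at `V`
  obtain ⟨-, hη2⟩ := differentiableAt_of_contDiffOn_two hO hη hV
  obtain ⟨-, hG2⟩ := differentiableAt_of_contDiffOn_two hO hG hV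
  have hR : HasFDerivAt (fun U => (fderiv ℝ η U).comp (fderiv ℝ Gα U))
      ((compL ℝ F F ℝ (fderiv ℝ η V)).comp (fderiv ℝ (fderiv ℝ Gα) V)
        + ((compL ℝ F F ℝ).flip (fderiv ℝ Gα V)).comp (fderiv ℝ (fderiv ℝ η) V)) V :=
    hη2.hasFDerivAt.clm_comp hG2.hasFDerivAt
  have hLR : fderiv ℝ qα =ᶠ[𝓝 V] fun U => (fderiv ℝ η U).comp (fderiv ℝ Gα U) := by
    filter_upwards [hO.mem_nhds hV] with U hU
    exact hcompat U hU
  have hD2q : fderiv ℝ (fderiv ℝ qα) V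
      = (compL ℝ F F ℝ (fderiv ℝ η V)).comp (fderiv ℝ (fderiv ℝ Gα) V)
        + ((compL ℝ F F ℝ).flip (fderiv ℝ Gα V)).comp (fderiv ℝ (fderiv ℝ η) V) := by
    rw [hLR.fderiv_eq]; exact hR.fderiv
  have key : ∀ v w, fderiv ℝ (fderiv ℝ qα) V v w
      = fderiv ℝ η V (fderiv ℝ (fderiv ℝ Gα) V v w)
        + fderiv ℝ (fderiv ℝ η) V v (fderiv ℝ Gα V w) := by
    intro v w
    rw [hD2q]
    simp
  have hsq := fderiv_fderiv_symm hO hq hV a b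
  have hsG := fderiv_fderiv_symm hO hG hV a b
  rw [key, key, hsG] at hsq
  linarith

end Pointwise

end Literature.Analysis.PDE.ConservationLaw

/-!
# The relative entropy inequality (5.2.10) of Dafermos

Topic `Literature/Analysis/PDE`. Sixth layer of the formalization of Dafermos' weak–strong
uniqueness theorem (`Literature.Analysis.PDE.ConservationLaw.dafermos_weak_strong_uniqueness`,
Dafermos 2000, Thm 5.2.1). We prove the integral inequality (5.2.10), p. 127, in the case of
equal initial data `U₀ = Ū₀ = Ū(·,0)` (so that its `t = 0` term vanishes):

  `∫∫ ψ ∑_α ∂_αŪᵀ D²η(Ū) Z_α(U,Ū) dx dt ≤ ∫∫ [∂ₜψ h(U,Ū) + ∑_α ∂_αψ f_α(U,Ū)] dx dt`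

for every nonnegative `C¹` test function `ψ` supported in `(-∞,T') × B(0,R)`, `0 < T' < T`
(`relEntropy_ineq`). The proof is Dafermos' ((5.2.6)–(5.2.9)): the admissibility inequality
(4.3.4) for `U` (`IsEntropyAdmissible.lipschitzTest`), the entropy EQUALITY for the classical
solution `Ū` (`classical_entropy_eq`), the weak formulations (4.1.6) of `U` and of `Ū` tested
against the components `ψ ∂η/∂U_i(Ū)` of the Lipschitz vector field `ψ Dη(Ū)`
(`IsWeakSolution.lipschitzTest`), the system satisfied a.e. by `Ū` (`classical_ae_pde`) and the
symmetry (4.3.2) (`fderiv_fderiv_apply_fderiv_symm`).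

Auxiliary (folklore): measurability of `θ ∘ V` on the slab for `θ` continuous on `O` and `V`
measurable with values in `D ⊆ O` (`aestronglyMeasurable_comp_of_continuousOn`), integrability of
bounded functions vanishing off a compact set (`integrable_restrict_of_norm_le_of_eq_zero`), the
product of a compactly supported Lipschitz function with a Lipschitz function
(`exists_lipschitzWith_mul`), and the coordinate expansion `∑ i, L(e_i) X_i = L X`.

[cite: Dafermos2000, Thm 5.2.1, (5.2.6)–(5.2.10)]

## References

* C. M. Dafermos, *Hyperbolic Conservation Laws in Continuum Physics*, Springer 2000, §5.2,
  pp. 126–127 [Dafermos2000].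
-/


open MeasureTheory Set Filter Metric ContinuousLinearMap
open scoped Topology NNReal BigOperators

namespace Literature.Analysis.PDE.ConservationLaw

variable {m n : ℕ}

/-! ## Auxiliary lemmas -/

/-- **Measurability of a composition.** If `θ` is continuous on a measurable set `A`, `V` is
a.e. strongly measurable and `V(x) ∈ A` for a.e. `x`, then `θ ∘ V` is a.e. strongly measurable
(no measurability of `θ` off `A` is needed). [folklore] -/
theorem aestronglyMeasurable_comp_of_continuousOn {X Y W' : Type*} [MeasurableSpace X]
    {μ : Measure X} [TopologicalSpace Y] [MeasurableSpace Y] [BorelSpace Y]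
    [TopologicalSpace.PseudoMetrizableSpace Y] [NormedAddCommGroup W']
    [SecondCountableTopology W'] [MeasurableSpace W'] [BorelSpace W']
    {A : Set Y} (hA : MeasurableSet A) {θ : Y → W'} (hθ : ContinuousOn θ A)
    {V : X → Y} (hV : AEStronglyMeasurable V μ) (hVA : ∀ᵐ x ∂μ, V x ∈ A) :
    AEStronglyMeasurable (fun x => θ (V x)) μ := by
  classical
  set g : Y → W' := A.piecewise θ (fun _ => 0) with hg
  have hgm : Measurable g := by
    refine measurable_of_restrict_of_restrict_compl hA ?_ ?_
    · have h1 : A.restrict g = A.restrict θ := by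
        funext x
        simp only [restrict_apply, hg, piecewise_eq_of_mem _ _ _ x.2]
      rw [h1]
      exact (continuousOn_iff_continuous_restrict.1 hθ).measurable
    · have h2 : Aᶜ.restrict g = fun _ => 0 := by
        funext x
        simp only [restrict_apply, hg, piecewise_eq_of_notMem _ _ _ x.2]
      rw [h2]
      exact measurable_const
  have hcomp : AEStronglyMeasurable (fun x => g (V x)) μ :=
    (hgm.comp_aemeasurable hV.aemeasurable).aestronglyMeasurable
  refine hcomp.congr ?_
  filter_upwards [hVA] with x hx
  simp only [hg, piecewise_eq_of_mem _ _ _ hx]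

/-- Measurability on the slab of `θ(V(p))` for `θ` continuous on `O` and `V` measurable with values
in `O` on the slab. [folklore] -/
theorem aestronglyMeasurable_comp_slab {W' : Type*} [NormedAddCommGroup W']
    [SecondCountableTopology W'] [MeasurableSpace W'] [BorelSpace W']
    {O : Set (EuclideanSpace ℝ (Fin n))} (hO : IsOpen O) {θ : EuclideanSpace ℝ (Fin n) → W'}
    (hθ : ContinuousOn θ O) {S : Set (ℝ × EuclideanSpace ℝ (Fin m))} (hS : MeasurableSet S)
    {V : ℝ × EuclideanSpace ℝ (Fin m) → EuclideanSpace ℝ (Fin n)} (hV : Measurable V)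
    (hVS : ∀ p ∈ S, V p ∈ O) :
    AEStronglyMeasurable (fun p => θ (V p)) (volume.restrict S) :=
  aestronglyMeasurable_comp_of_continuousOn hO.measurableSet hθ hV.aestronglyMeasurable
    ((ae_restrict_mem hS).mono fun p hp => hVS p hp)

/-- A bounded a.e. strongly measurable function on `S` vanishing off a compact set is integrable on
`S`. [folklore] -/
theorem integrable_restrict_of_norm_le_of_eq_zero {W' : Type*} [NormedAddCommGroup W']
    {S Kc : Set (ℝ × EuclideanSpace ℝ (Fin m))} (hS : MeasurableSet S) (hKc : IsCompact Kc)
    {f : ℝ × EuclideanSpace ℝ (Fin m) → W'} (hf : AEStronglyMeasurable f (volume.restrict S))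
    {M : ℝ} (hM : ∀ᵐ p ∂(volume.restrict S), ‖f p‖ ≤ M) (h0 : ∀ p, p ∉ Kc → f p = 0) :
    Integrable f (volume.restrict S) := by
  haveI : (volume : Measure (ℝ × EuclideanSpace ℝ (Fin m))).IsAddHaarMeasure :=
    Measure.prod.instIsAddHaarMeasure _ _
  have h1 : IntegrableOn f Kc (volume.restrict S) := by
    refine Measure.integrableOn_of_bounded ?_ hf (ae_restrict_of_ae hM)
    exact ((Measure.restrict_apply_le S Kc).trans_lt hKc.measure_lt_top).ne
  have h2 : IntegrableOn f (Kc ∩ S) volume := by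
    have := h1
    rw [IntegrableOn, Measure.restrict_restrict hKc.measurableSet] at this
    exact this
  exact h2.of_forall_sdiff_eq_zero hS fun p hp => h0 p fun h => hp.2 ⟨h, hp.1⟩

/-- The product of a compactly supported Lipschitz function with a Lipschitz function is Lipschitz.
[folklore] -/
theorem exists_lipschitzWith_mul {V : Type*} [PseudoMetricSpace V] {ψ w : V → ℝ} {Kψ Kw : ℝ≥0}
    (hψ : LipschitzWith Kψ ψ) (hψc : HasCompactSupport ψ) (hw : LipschitzWith Kw w) :
    ∃ K : ℝ≥0, LipschitzWith K fun p => ψ p * w p := by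
  obtain ⟨Mψ₀, hMψ₀⟩ := hψ.continuous.bounded_above_of_compact_support hψc
  obtain ⟨Mw, hMw⟩ := hψc.isCompact.exists_bound_of_continuousOn hw.continuous.continuousOn
  set Mψ : ℝ := max Mψ₀ 0 with hMψdef
  have hMψ : ∀ p, ‖ψ p‖ ≤ Mψ := fun p => (hMψ₀ p).trans (le_max_left _ _)
  have hMψ0 : 0 ≤ Mψ := le_max_right _ _
  have hMw' : ∀ p, ψ p ≠ 0 → ‖w p‖ ≤ max Mw 0 := fun p hp =>
    (hMw p (subset_tsupport _ hp)).trans (le_max_left _ _)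
  refine ⟨Kψ * (max Mw 0).toNNReal + Mψ.toNNReal * Kw, LipschitzWith.of_dist_le_mul fun p q => ?_⟩
  have key : ∀ p q, ψ p ≠ 0 →
      dist (ψ p * w p) (ψ q * w q) ≤ (Kψ * max Mw 0 + Mψ * Kw) * dist p q := by
    intro p q hp
    have h1 : ψ p * w p - ψ q * w q = (ψ p - ψ q) * w p + ψ q * (w p - w q) := by ring
    rw [dist_eq_norm, h1]
    refine (norm_add_le _ _).trans ?_
    rw [norm_mul, norm_mul, add_mul]
    refine add_le_add ?_ ?_
    · rw [← dist_eq_norm]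
      calc dist (ψ p) (ψ q) * ‖w p‖ ≤ (Kψ * dist p q) * max Mw 0 :=
            mul_le_mul (hψ.dist_le_mul p q) (hMw' p hp) (norm_nonneg _) (by positivity)
        _ = Kψ * max Mw 0 * dist p q := by ring
    · rw [← dist_eq_norm]
      calc ‖ψ q‖ * dist (w p) (w q) ≤ Mψ * (Kw * dist p q) :=
            mul_le_mul (hMψ q) (hw.dist_le_mul p q) dist_nonneg hMψ0
        _ = Mψ * Kw * dist p q := by ring
  have hcoe : ((Kψ * (max Mw 0).toNNReal + Mψ.toNNReal * Kw : ℝ≥0) : ℝ) = Kψ * max Mw 0 + Mψ * Kw := by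
    simp [Real.coe_toNNReal _ (le_max_right _ _), Real.coe_toNNReal _ hMψ0]
  rw [hcoe]
  by_cases hp : ψ p = 0
  · by_cases hq : ψ q = 0
    · rw [hp, hq, zero_mul, zero_mul, dist_self]
      positivity
    · rw [dist_comm, dist_comm p q]
      exact key q p hq
  · exact key p q hp

/-- Coordinate expansion of a linear functional on `ℝⁿ`: `∑ i, L(e_i) X_i = L X`. [folklore] -/
theorem sum_apply_single_mul (L : EuclideanSpace ℝ (Fin n) →L[ℝ] ℝ) (X : EuclideanSpace ℝ (Fin n)) :
    ∑ i, L (EuclideanSpace.single i (1 : ℝ)) * X i = L X := by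
  have h : ∑ i, X i • EuclideanSpace.single i (1 : ℝ) = X := by
    simpa using (EuclideanSpace.basisFun (Fin n) ℝ).sum_repr X
  conv_rhs => rw [← h]
  rw [map_sum]
  refine Finset.sum_congr rfl fun i _ => ?_
  rw [map_smul, smul_eq_mul, mul_comm]

/-! ## The relative entropy inequality -/

set_option maxHeartbeats 1600000 in -- one long assembly proof (Dafermos (5.2.6)–(5.2.10))
/-- **Dafermos' relative entropy inequality (5.2.10), equal initial data.** Let the system be
endowed with a uniformly convex entropy (`IsConvexEntropySystem`), `𝒟 ⊆ 𝒪` convex compact, `Ū` a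
classical solution on `[0,T)` with values in `𝒟`, `U` an admissible weak solution on `[0,T)`
with initial data `Ū(·,0)` and values in `𝒟`. Then for every nonnegative `C¹` test function `ψ`
supported in `(-∞,T') × B(0,R)`, `0 < T' < T`,
`∫_{(0,T)×ℝ^m} ψ ∑_α D²η(Ū)[∂_αŪ, Z_α(U,Ū)] ≤ ∫_{(0,T)×ℝ^m} [Dψ(1,0) h(U,Ū) + ∑_α Dψ(0,e_α) f_α(U,Ū)]`
with `h`, `f_α`, `Z_α` of (5.2.2)–(5.2.4); the two integrands are integrable on the slab (recorded
in the conclusion for later use). [cite: Dafermos2000, Thm 5.2.1 (5.2.10)] -/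
theorem relEntropy_ineq {O : Set (EuclideanSpace ℝ (Fin n))}
    {G : Fin m → EuclideanSpace ℝ (Fin n) → EuclideanSpace ℝ (Fin n)}
    {η : EuclideanSpace ℝ (Fin n) → ℝ} {q : Fin m → EuclideanSpace ℝ (Fin n) → ℝ}
    (hsys : IsConvexEntropySystem O G η q)
    {D : Set (EuclideanSpace ℝ (Fin n))} (hD : D ⊆ O) (hDc : IsCompact D) (hDconv : Convex ℝ D)
    {T : ℝ} {Ubar : ℝ → EuclideanSpace ℝ (Fin m) → EuclideanSpace ℝ (Fin n)}
    (hŪ : IsClassicalSolution O G T Ubar) (hŪD : ∀ t ∈ Ico 0 T, ∀ x, Ubar t x ∈ D)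
    {U : ℝ → EuclideanSpace ℝ (Fin m) → EuclideanSpace ℝ (Fin n)}
    (hUw : IsWeakSolution O G T U (Ubar 0)) (hUadm : IsEntropyAdmissible η q T U (Ubar 0))
    (hUD : ∀ t ∈ Ico 0 T, ∀ x, U t x ∈ D)
    {T' R : ℝ} (hT'0 : 0 < T') (hT' : T' < T)
    {ψ : ℝ × EuclideanSpace ℝ (Fin m) → ℝ} (hψ : ContDiff ℝ 1 ψ) (hψc : HasCompactSupport ψ)
    (hψnn : ∀ p, 0 ≤ ψ p) (hψs : tsupport ψ ⊆ Iio T' ×ˢ ball (0 : EuclideanSpace ℝ (Fin m)) R) :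
    Integrable (fun p : ℝ × EuclideanSpace ℝ (Fin m) => ψ p * ∑ α : Fin m,
        fderiv ℝ (fderiv ℝ η) (Ubar p.1 p.2)
          (fderiv ℝ (Function.uncurry Ubar) p (0, EuclideanSpace.single α (1 : ℝ)))
          (G α (U p.1 p.2) - G α (Ubar p.1 p.2)
            - fderiv ℝ (G α) (Ubar p.1 p.2) (U p.1 p.2 - Ubar p.1 p.2)))
      (volume.restrict (Ioo 0 T ×ˢ univ)) ∧
    Integrable (fun p : ℝ × EuclideanSpace ℝ (Fin m) => fderiv ℝ ψ p (1, 0)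
          * (η (U p.1 p.2) - η (Ubar p.1 p.2) - fderiv ℝ η (Ubar p.1 p.2) (U p.1 p.2 - Ubar p.1 p.2))
        + ∑ α : Fin m, fderiv ℝ ψ p (0, EuclideanSpace.single α (1 : ℝ))
          * (q α (U p.1 p.2) - q α (Ubar p.1 p.2)
            - fderiv ℝ η (Ubar p.1 p.2) (G α (U p.1 p.2) - G α (Ubar p.1 p.2))))
      (volume.restrict (Ioo 0 T ×ˢ univ)) ∧
    ∫ p in Ioo 0 T ×ˢ univ, ψ p * ∑ α : Fin m, fderiv ℝ (fderiv ℝ η) (Ubar p.1 p.2)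
        (fderiv ℝ (Function.uncurry Ubar) p (0, EuclideanSpace.single α (1 : ℝ)))
        (G α (U p.1 p.2) - G α (Ubar p.1 p.2)
          - fderiv ℝ (G α) (Ubar p.1 p.2) (U p.1 p.2 - Ubar p.1 p.2))
      ≤ ∫ p in Ioo 0 T ×ˢ univ, (fderiv ℝ ψ p (1, 0)
          * (η (U p.1 p.2) - η (Ubar p.1 p.2) - fderiv ℝ η (Ubar p.1 p.2) (U p.1 p.2 - Ubar p.1 p.2))
        + ∑ α : Fin m, fderiv ℝ ψ p (0, EuclideanSpace.single α (1 : ℝ))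
          * (q α (U p.1 p.2) - q α (Ubar p.1 p.2)
            - fderiv ℝ η (Ubar p.1 p.2) (G α (U p.1 p.2) - G α (Ubar p.1 p.2)))) := by
  classical
  haveI : (volume : Measure (ℝ × EuclideanSpace ℝ (Fin m))).IsAddHaarMeasure :=
    Measure.prod.instIsAddHaarMeasure _ _
  obtain ⟨hO, hGs, hηs, hqs, hcompat, hconv⟩ := hsys
  obtain ⟨hŪw, hŪlip⟩ := hŪ
  obtain ⟨K, hK⟩ := hŪlip T' hT' R
  have hTpos : 0 < T := hT'0.trans hT'
  -- smoothness levels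
  have hG1 : ∀ α, ContDiffOn ℝ 1 (G α) O := fun α => by exact contDiffOn_infty.1 (hGs α) 1
  have hG2 : ∀ α, ContDiffOn ℝ 2 (G α) O := fun α => by exact contDiffOn_infty.1 (hGs α) 2
  have hη1 : ContDiffOn ℝ 1 η O := by exact contDiffOn_infty.1 hηs 1
  have hη2 : ContDiffOn ℝ 2 η O := by exact contDiffOn_infty.1 hηs 2
  have hq1 : ∀ α, ContDiffOn ℝ 1 (q α) O := fun α => by exact contDiffOn_infty.1 (hqs α) 1
  have hq2 : ∀ α, ContDiffOn ℝ 2 (q α) O := fun α => by exact contDiffOn_infty.1 (hqs α) 2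
  have hUnc : ∀ p : ℝ × EuclideanSpace ℝ (Fin m), Function.uncurry Ubar p = Ubar p.1 p.2 :=
    fun p => rfl
  -- boxes and the slab
  set Bc : Set (ℝ × EuclideanSpace ℝ (Fin m)) := Icc 0 T' ×ˢ closedBall 0 R with hBc
  set Bo : Set (ℝ × EuclideanSpace ℝ (Fin m)) := Ioo 0 T' ×ˢ ball 0 R with hBo
  set S : Set (ℝ × EuclideanSpace ℝ (Fin m)) := Ioo 0 T ×ˢ univ with hSdef
  have hSm : MeasurableSet S := measurableSet_Ioo.prod MeasurableSet.univ
  have hBoBc : Bo ⊆ Bc := Set.prod_mono Ioo_subset_Icc_self ball_subset_closedBall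
  have hBcD : ∀ p ∈ Bc, Function.uncurry Ubar p ∈ D := fun p hp =>
    hŪD p.1 ⟨hp.1.1, lt_of_le_of_lt hp.1.2 hT'⟩ p.2
  have hBo_nhds : ∀ p ∈ Bo, Bc ∈ 𝓝 p := fun p hp =>
    Filter.mem_of_superset ((isOpen_Ioo.prod isOpen_ball).mem_nhds hp) hBoBc
  have hSD_U : ∀ p ∈ S, U p.1 p.2 ∈ D := fun p hp => hUD p.1 (Ioo_subset_Ico_self hp.1) p.2
  have hSD_Ū : ∀ p ∈ S, Ubar p.1 p.2 ∈ D := fun p hp => hŪD p.1 (Ioo_subset_Ico_self hp.1) p.2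
  have hSmem : ∀ᵐ p ∂(volume.restrict S), p ∈ S := ae_restrict_mem hSm
  -- support facts for `ψ`
  have hψ_out : ∀ p : ℝ × EuclideanSpace ℝ (Fin m), p ∉ Iio T' ×ˢ ball (0 : EuclideanSpace ℝ (Fin m)) R
      → ψ p = 0 := fun p hp => image_eq_zero_of_notMem_tsupport fun h => hp (hψs h)
  have hψT : ∀ t x, T' ≤ t → ψ (t, x) = 0 := fun t x ht =>
    hψ_out (t, x) fun h => not_lt.mpr ht h.1
  have hsupp_S : ∀ p ∈ tsupport ψ, p ∈ S → p ∈ Bo := fun p hp hs =>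
    ⟨⟨hs.1.1, (hψs hp).1⟩, (hψs hp).2⟩
  have hDψ0 : ∀ p : ℝ × EuclideanSpace ℝ (Fin m), p ∉ tsupport ψ → fderiv ℝ ψ p = 0 := fun p hp =>
    fderiv_eq_zero_of_notMem_tsupport hp
  obtain ⟨Kψ, hψlip⟩ := hψ.lipschitzWith_of_hasCompactSupport hψc one_ne_zero
  obtain ⟨Mψ, hMψ⟩ := hψ.continuous.bounded_above_of_compact_support hψc
  have hψd : Differentiable ℝ ψ := hψ.differentiable one_ne_zero
  have hDψcont : ∀ v, Continuous fun p => fderiv ℝ ψ p v := fun v =>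
    (hψ.continuous_fderiv one_ne_zero).clm_apply continuous_const
  have hDψcs : ∀ v, HasCompactSupport fun p => fderiv ℝ ψ p v := fun v =>
    hψc.fderiv_apply (𝕜 := ℝ) v
  -- bounds over `D`
  obtain ⟨Mη, hMη⟩ : ∃ M : ℝ, ∀ V ∈ D, ‖η V‖ ≤ M :=
    exists_norm_le_of_continuousOn hηs.continuousOn hD hDc
  have hMq : ∃ M : ℝ, ∀ α, ∀ V ∈ D, ‖q α V‖ ≤ M := by
    have h1 : ∀ α, ∃ M : ℝ, ∀ V ∈ D, ‖q α V‖ ≤ M := fun α =>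
      exists_norm_le_of_continuousOn (hqs α).continuousOn hD hDc
    choose Mα hMα using h1
    refine ⟨∑ α, |Mα α|, fun α V hV => (hMα α V hV).trans ((le_abs_self _).trans ?_)⟩
    exact Finset.single_le_sum (f := fun α => |Mα α|) (fun α _ => abs_nonneg _) (Finset.mem_univ α)
  obtain ⟨Mq, hMq⟩ := hMq
  have hMG : ∃ M : ℝ, ∀ α, ∀ V ∈ D, ‖G α V‖ ≤ M := by
    have h1 : ∀ α, ∃ M : ℝ, ∀ V ∈ D, ‖G α V‖ ≤ M := fun α =>
      exists_norm_le_of_continuousOn (hGs α).continuousOn hD hDc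
    choose Mα hMα using h1
    refine ⟨∑ α, |Mα α|, fun α V hV => (hMα α V hV).trans ((le_abs_self _).trans ?_)⟩
    exact Finset.single_le_sum (f := fun α => |Mα α|) (fun α _ => abs_nonneg _) (Finset.mem_univ α)
  obtain ⟨MG, hMG⟩ := hMG
  have hMDG : ∃ M : ℝ, ∀ α, ∀ V ∈ D, ‖fderiv ℝ (G α) V‖ ≤ M := by
    have h1 : ∀ α, ∃ M : ℝ, ∀ V ∈ D, ‖fderiv ℝ (G α) V‖ ≤ M := fun α => by
      obtain ⟨M, -, hM⟩ := exists_forall_norm_fderiv_le hO (hG1 α) hD hDc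
      exact ⟨M, hM⟩
    choose Mα hMα using h1
    refine ⟨∑ α, |Mα α|, fun α V hV => (hMα α V hV).trans ((le_abs_self _).trans ?_)⟩
    exact Finset.single_le_sum (f := fun α => |Mα α|) (fun α _ => abs_nonneg _) (Finset.mem_univ α)
  obtain ⟨MDG, hMDG⟩ := hMDG
  obtain ⟨M1, hM1nn, hM1⟩ := exists_forall_norm_fderiv_le hO hη1 hD hDc
  obtain ⟨M2, hM2nn, hM2⟩ := exists_forall_norm_fderiv_fderiv_le hO hη2 hD hDc
  obtain ⟨LDη, hLDη⟩ := exists_lipschitzOnWith_fderiv hO hη2 hD hDc hDconv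
  -- data of the two weak solutions
  have hUm : Measurable (Function.uncurry U) := hUw.1
  have hŪm : Measurable (Function.uncurry Ubar) := hŪw.1
  obtain ⟨CU, hUC, -⟩ := hUw.2.2.2.2.1
  obtain ⟨CŪ, hŪC, -⟩ := hŪw.2.2.2.2.1
  have hGM_U : ∀ α, ∀ t ∈ Ioo 0 T, ∀ x, ‖G α (U t x)‖ ≤ MG := fun α t ht x =>
    hMG α _ (hUD t (Ioo_subset_Ico_self ht) x)
  have hGM_Ū : ∀ α, ∀ t ∈ Ioo 0 T, ∀ x, ‖G α (Ubar t x)‖ ≤ MG := fun α t ht x =>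
    hMG α _ (hŪD t (Ioo_subset_Ico_self ht) x)
  ----------------------------------------------------------------
  -- Step (I): admissibility of `U` tested with `ψ`
  ----------------------------------------------------------------
  have hŪ0cont : Continuous fun x : EuclideanSpace ℝ (Fin m) => Ubar 0 x := by
    refine continuous_iff_continuousAt.2 fun x => ?_
    obtain ⟨K', hK'⟩ := hŪlip T' hT' (‖x‖ + 1)
    have h2 : ContinuousOn (fun y : EuclideanSpace ℝ (Fin m) => Function.uncurry Ubar ((0 : ℝ), y))
        (closedBall 0 (‖x‖ + 1)) :=
      hK'.continuousOn.comp (continuous_const.prodMk continuous_id).continuousOn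
        (fun y hy => ⟨⟨le_rfl, hT'0.le⟩, hy⟩)
    have hx : closedBall (0 : EuclideanSpace ℝ (Fin m)) (‖x‖ + 1) ∈ 𝓝 x :=
      Filter.mem_of_superset (isOpen_ball.mem_nhds (by simp)) ball_subset_closedBall
    exact h2.continuousAt hx
  have hη0m : AEStronglyMeasurable (fun x => η (Ubar 0 x)) volume :=
    (hηs.continuousOn.comp_continuous hŪ0cont
      (fun x => hD (hŪD 0 ⟨le_rfl, hTpos⟩ x))).aestronglyMeasurable
  set Mall : ℝ := max Mη Mq with hMall
  have hηM_U : ∀ t ∈ Ioo 0 T, ∀ x, ‖η (U t x)‖ ≤ Mall := fun t ht x =>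
    (hMη _ (hUD t (Ioo_subset_Ico_self ht) x)).trans (le_max_left _ _)
  have hqM_U : ∀ α, ∀ t ∈ Ioo 0 T, ∀ x, ‖q α (U t x)‖ ≤ Mall := fun α t ht x =>
    (hMq α _ (hUD t (Ioo_subset_Ico_self ht) x)).trans (le_max_right _ _)
  have hη0M : ∀ x, ‖η (Ubar 0 x)‖ ≤ Mall := fun x =>
    (hMη _ (hŪD 0 ⟨le_rfl, hTpos⟩ x)).trans (le_max_left _ _)
  have hI := IsEntropyAdmissible.lipschitzTest hUadm hη0m hηM_U hqM_U hη0M hψlip hψc hψnn hT' hψT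
  ----------------------------------------------------------------
  -- Step (II): the entropy equality for `Ū`
  ----------------------------------------------------------------
  have hII := classical_entropy_eq hO hG1 hη1 hq1 hcompat hD hDc hDconv hŪw hŪD hT'0 hT' hK hψ hψc hψs
  ----------------------------------------------------------------
  -- notation for directions (introduced now, so that `hI`, `hII` are rewritten too)
  ----------------------------------------------------------------
  set e₀ : ℝ × EuclideanSpace ℝ (Fin m) := (1, 0) with he₀
  set e : Fin m → ℝ × EuclideanSpace ℝ (Fin m) :=
    fun α => (0, EuclideanSpace.single α (1 : ℝ)) with he
  set b : Fin n → EuclideanSpace ℝ (Fin n) := fun i => EuclideanSpace.single i (1 : ℝ) with hb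
  have he₀n : ‖e₀‖ = 1 := norm_timeDir
  have hen : ∀ α, ‖e α‖ = 1 := fun α => norm_spaceDir α
  ----------------------------------------------------------------
  -- Step (III): the Lipschitz test functions `Φ_i = ψ ∂η/∂U_i(Ū)`
  ----------------------------------------------------------------
  have hwL : ∀ i, LipschitzOnWith (‖ContinuousLinearMap.apply ℝ ℝ (b i)‖₊ * LDη)
      (fun V => fderiv ℝ η V (b i)) D := fun i => by
    have := (ContinuousLinearMap.apply ℝ ℝ (b i)).lipschitz.comp_lipschitzOnWith hLDη
    simpa [Function.comp_def] using this
  have hWex : ∀ i, ∃ Wt : ℝ × EuclideanSpace ℝ (Fin m) → ℝ, ∃ KW : ℝ≥0, LipschitzWith KW Wt ∧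
      ∀ p ∈ Bc, Wt p = fderiv ℝ η (Function.uncurry Ubar p) (b i) := fun i =>
    exists_lipschitz_extension hK hBcD (hwL i)
  choose Wt KW hWlip hWeq using hWex
  set Φ : Fin n → ℝ × EuclideanSpace ℝ (Fin m) → ℝ := fun i p => ψ p * Wt i p with hΦdef
  have hΦex : ∀ i, ∃ KΦ : ℝ≥0, LipschitzWith KΦ (Φ i) := fun i =>
    exists_lipschitzWith_mul hψlip hψc (hWlip i)
  choose KΦ hΦlip using hΦex
  have hΦc : ∀ i, HasCompactSupport (Φ i) := fun i => hψc.mul_right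
  have hΦT : ∀ i, ∀ t x, T' ≤ t → Φ i (t, x) = 0 := by
    intro i t x ht
    simp only [hΦdef, hψT t x ht, zero_mul]
  have hΦsupp : ∀ i, tsupport (Φ i) ⊆ tsupport ψ := fun i => tsupport_mul_subset_left
  have hDΦ0 : ∀ i (p : ℝ × EuclideanSpace ℝ (Fin m)), p ∉ tsupport ψ → fderiv ℝ (Φ i) p = 0 :=
    fun i p hp => fderiv_eq_zero_of_notMem_tsupport fun h => hp (hΦsupp i h)
  have hDΦbd : ∀ i p v, ‖fderiv ℝ (Φ i) p v‖ ≤ KΦ i * ‖v‖ := fun i p v => by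
    rw [Real.norm_eq_abs]; exact abs_fderiv_apply_le_of_lipschitz (hΦlip i) p v
  -- the two weak formulations tested with `Φ_i`
  have hWU : ∀ i, (∫ p in S, (fderiv ℝ (Φ i) p e₀ • U p.1 p.2
        + ∑ α : Fin m, fderiv ℝ (Φ i) p (e α) • G α (U p.1 p.2)))
      + ∫ x, Φ i (0, x) • Ubar 0 x = 0 := fun i =>
    IsWeakSolution.lipschitzTest hUw hGM_U (hΦlip i) (hΦc i) hT' (hΦT i)
  have hWŪ : ∀ i, (∫ p in S, (fderiv ℝ (Φ i) p e₀ • Ubar p.1 p.2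
        + ∑ α : Fin m, fderiv ℝ (Φ i) p (e α) • G α (Ubar p.1 p.2)))
      + ∫ x, Φ i (0, x) • Ubar 0 x = 0 := fun i =>
    IsWeakSolution.lipschitzTest hŪw hGM_Ū (hΦlip i) (hΦc i) hT' (hΦT i)
  -- measurability of the fields on the slab
  have hu_U : AEStronglyMeasurable (fun p : ℝ × EuclideanSpace ℝ (Fin m) => U p.1 p.2)
      (volume.restrict S) := hUm.aestronglyMeasurable
  have hu_Ū : AEStronglyMeasurable (fun p : ℝ × EuclideanSpace ℝ (Fin m) => Ubar p.1 p.2)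
      (volume.restrict S) := hŪm.aestronglyMeasurable
  have hg_U : ∀ α, AEStronglyMeasurable (fun p : ℝ × EuclideanSpace ℝ (Fin m) => G α (U p.1 p.2))
      (volume.restrict S) := fun α =>
    aestronglyMeasurable_comp_slab (θ := G α)
      (V := fun p : ℝ × EuclideanSpace ℝ (Fin m) => U p.1 p.2) hO
      (hGs α).continuousOn hSm hUm (fun p hp => hD (hSD_U p hp))
  have hg_Ū : ∀ α, AEStronglyMeasurable (fun p : ℝ × EuclideanSpace ℝ (Fin m) => G α (Ubar p.1 p.2))
      (volume.restrict S) := fun α =>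
    aestronglyMeasurable_comp_slab (θ := G α)
      (V := fun p : ℝ × EuclideanSpace ℝ (Fin m) => Ubar p.1 p.2) hO
      (hGs α).continuousOn hSm hŪm (fun p hp => hD (hSD_Ū p hp))
  have hDΦm : ∀ i v, AEStronglyMeasurable (fun p => fderiv ℝ (Φ i) p v) (volume.restrict S) :=
    fun i v => (measurable_fderiv_apply (Φ i) v).aestronglyMeasurable
  -- integrability of the vector integrands
  have hintv : ∀ (i) (Uf : ℝ × EuclideanSpace ℝ (Fin m) → EuclideanSpace ℝ (Fin n))
      (Gf : Fin m → ℝ × EuclideanSpace ℝ (Fin m) → EuclideanSpace ℝ (Fin n)) (C : ℝ),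
      AEStronglyMeasurable Uf (volume.restrict S) →
      (∀ α, AEStronglyMeasurable (Gf α) (volume.restrict S)) →
      (∀ p ∈ S, ‖Uf p‖ ≤ C) → (∀ α, ∀ p ∈ S, ‖Gf α p‖ ≤ C) →
      Integrable (fun p => fderiv ℝ (Φ i) p e₀ • Uf p
        + ∑ α : Fin m, fderiv ℝ (Φ i) p (e α) • Gf α p) (volume.restrict S) := by
    intro i Uf Gf C hUf hGf hUfC hGfC
    have hC : 0 ≤ C ∨ S = ∅ := by
      by_cases hSe : S = ∅
      · exact Or.inr hSe
      · obtain ⟨p, hp⟩ := Set.nonempty_iff_ne_empty.2 hSe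
        exact Or.inl ((norm_nonneg _).trans (hUfC p hp))
    refine Integrable.add ?_ (integrable_finsetSum _ fun α _ => ?_)
    · refine integrable_restrict_of_norm_le_of_eq_zero hSm hψc.isCompact
        ((hDΦm i e₀).smul hUf) (M := KΦ i * ‖e₀‖ * |C|) ?_ fun p hp => ?_
      · filter_upwards [hSmem] with p hp
        rw [norm_smul]
        exact mul_le_mul (hDΦbd i p e₀) ((hUfC p hp).trans (le_abs_self _)) (norm_nonneg _)
          (by positivity)
      · rw [hDΦ0 i p hp]; simp
    · refine integrable_restrict_of_norm_le_of_eq_zero hSm hψc.isCompact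
        ((hDΦm i (e α)).smul (hGf α)) (M := KΦ i * ‖e α‖ * |C|) ?_ fun p hp => ?_
      · filter_upwards [hSmem] with p hp
        rw [norm_smul]
        exact mul_le_mul (hDΦbd i p (e α)) ((hGfC α p hp).trans (le_abs_self _)) (norm_nonneg _)
          (by positivity)
      · rw [hDΦ0 i p hp]; simp
  have hint_U : ∀ i, Integrable (fun p => fderiv ℝ (Φ i) p e₀ • U p.1 p.2
      + ∑ α : Fin m, fderiv ℝ (Φ i) p (e α) • G α (U p.1 p.2)) (volume.restrict S) := fun i =>
    hintv i _ _ (max CU MG) hu_U hg_U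
      (fun p hp => (hUC p.1 (Ioo_subset_Ico_self hp.1) p.2).trans (le_max_left _ _))
      (fun α p hp => (hGM_U α p.1 hp.1 p.2).trans (le_max_right _ _))
  have hint_Ū : ∀ i, Integrable (fun p => fderiv ℝ (Φ i) p e₀ • Ubar p.1 p.2
      + ∑ α : Fin m, fderiv ℝ (Φ i) p (e α) • G α (Ubar p.1 p.2)) (volume.restrict S) := fun i =>
    hintv i _ _ (max CŪ MG) hu_Ū hg_Ū
      (fun p hp => (hŪC p.1 (Ioo_subset_Ico_self hp.1) p.2).trans (le_max_left _ _))
      (fun α p hp => (hGM_Ū α p.1 hp.1 p.2).trans (le_max_right _ _))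
  -- the difference of the two weak formulations
  set dv : Fin n → ℝ × EuclideanSpace ℝ (Fin m) → EuclideanSpace ℝ (Fin n) := fun i p =>
    fderiv ℝ (Φ i) p e₀ • (U p.1 p.2 - Ubar p.1 p.2)
      + ∑ α : Fin m, fderiv ℝ (Φ i) p (e α) • (G α (U p.1 p.2) - G α (Ubar p.1 p.2)) with hdv
  have hdv_eq : ∀ i p, dv i p = (fderiv ℝ (Φ i) p e₀ • U p.1 p.2
        + ∑ α : Fin m, fderiv ℝ (Φ i) p (e α) • G α (U p.1 p.2))
      - (fderiv ℝ (Φ i) p e₀ • Ubar p.1 p.2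
        + ∑ α : Fin m, fderiv ℝ (Φ i) p (e α) • G α (Ubar p.1 p.2)) := by
    intro i p
    simp only [hdv, smul_sub, Finset.sum_sub_distrib]
    abel
  have hint_dv : ∀ i, Integrable (dv i) (volume.restrict S) := fun i =>
    ((hint_U i).sub (hint_Ū i)).congr (ae_of_all _ fun p => (hdv_eq i p).symm)
  have hdv0 : ∀ i, ∫ p in S, dv i p = 0 := by
    intro i
    have h1 := eq_neg_of_add_eq_zero_left (hWU i)
    have h2 := eq_neg_of_add_eq_zero_left (hWŪ i)
    calc ∫ p in S, dv i p
        = (∫ p in S, (fderiv ℝ (Φ i) p e₀ • U p.1 p.2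
            + ∑ α : Fin m, fderiv ℝ (Φ i) p (e α) • G α (U p.1 p.2)))
          - ∫ p in S, (fderiv ℝ (Φ i) p e₀ • Ubar p.1 p.2
            + ∑ α : Fin m, fderiv ℝ (Φ i) p (e α) • G α (Ubar p.1 p.2)) := by
          rw [← integral_sub (hint_U i) (hint_Ū i)]
          exact integral_congr_ae (ae_of_all _ fun p => hdv_eq i p)
      _ = 0 := by rw [h1, h2, sub_self]
  -- coordinates, summed over `i`
  set cd : ℝ × EuclideanSpace ℝ (Fin m) → ℝ := fun p => ∑ i : Fin n,
    (fderiv ℝ (Φ i) p e₀ * (U p.1 p.2 - Ubar p.1 p.2) i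
      + ∑ α : Fin m, fderiv ℝ (Φ i) p (e α) * (G α (U p.1 p.2) - G α (Ubar p.1 p.2)) i) with hcd
  have hcd_i : ∀ i p, (EuclideanSpace.proj i : EuclideanSpace ℝ (Fin n) →L[ℝ] ℝ) (dv i p)
      = fderiv ℝ (Φ i) p e₀ * (U p.1 p.2 - Ubar p.1 p.2) i
        + ∑ α : Fin m, fderiv ℝ (Φ i) p (e α) * (G α (U p.1 p.2) - G α (Ubar p.1 p.2)) i := by
    intro i p
    simp [hdv, Finset.sum_apply]
  have hint_cdi : ∀ i, Integrable (fun p => fderiv ℝ (Φ i) p e₀ * (U p.1 p.2 - Ubar p.1 p.2) i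
      + ∑ α : Fin m, fderiv ℝ (Φ i) p (e α) * (G α (U p.1 p.2) - G α (Ubar p.1 p.2)) i)
      (volume.restrict S) := fun i =>
    (((EuclideanSpace.proj i : EuclideanSpace ℝ (Fin n) →L[ℝ] ℝ)).integrable_comp (hint_dv i)).congr
      (ae_of_all _ fun p => hcd_i i p)
  have hint_cd : Integrable cd (volume.restrict S) := by
    simp only [hcd]
    exact integrable_finsetSum _ fun i _ => hint_cdi i
  have hcd0 : ∫ p in S, cd p = 0 := by
    simp only [hcd]
    rw [integral_finsetSum _ fun i _ => hint_cdi i]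
    refine Finset.sum_eq_zero fun i _ => ?_
    have h1 := (EuclideanSpace.proj i : EuclideanSpace ℝ (Fin n) →L[ℝ] ℝ).integral_comp_comm (hint_dv i)
    rw [hdv0 i, map_zero] at h1
    rw [← h1]
    exact integral_congr_ae (ae_of_all _ fun p => (hcd_i i p).symm)
  ----------------------------------------------------------------
  -- Step (IV): the pointwise identity `cd = Cterm + ψ g` a.e. on the slab
  ----------------------------------------------------------------
  set Cterm : ℝ × EuclideanSpace ℝ (Fin m) → ℝ := fun p =>
    fderiv ℝ ψ p e₀ * fderiv ℝ η (Ubar p.1 p.2) (U p.1 p.2 - Ubar p.1 p.2)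
      + ∑ α : Fin m, fderiv ℝ ψ p (e α)
          * fderiv ℝ η (Ubar p.1 p.2) (G α (U p.1 p.2) - G α (Ubar p.1 p.2)) with hCterm
  set g : ℝ × EuclideanSpace ℝ (Fin m) → ℝ := fun p => ∑ α : Fin m,
    fderiv ℝ (fderiv ℝ η) (Ubar p.1 p.2)
      (fderiv ℝ (Function.uncurry Ubar) p (e α))
      (G α (U p.1 p.2) - G α (Ubar p.1 p.2)
        - fderiv ℝ (G α) (Ubar p.1 p.2) (U p.1 p.2 - Ubar p.1 p.2)) with hg
  have hpde := classical_ae_pde hO hG1 hD hDc hDconv hŪw hŪD hT' hK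
  have hη2d : ∀ V ∈ D, DifferentiableAt ℝ (fderiv ℝ η) V := fun V hV =>
    (differentiableAt_of_contDiffOn_two hO hη2 (hD hV)).2
  have hident : ∀ᵐ p ∂(volume.restrict S), cd p = Cterm p + ψ p * g p := by
    filter_upwards [hSmem, ae_restrict_of_ae (s := S) hpde] with p hpS hp
    by_cases hps : p ∈ tsupport ψ
    · -- on the support: `p ∈ Bo`, `Ū` differentiable at `p`, the system holds at `p`
      have hpo : p ∈ Bo := hsupp_S p hps hpS
      have hpc : p ∈ Bc := hBoBc hpo
      obtain ⟨hd, hsysp⟩ := hp hpo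
      have hpD : Function.uncurry Ubar p ∈ D := hBcD p hpc
      -- derivative of `Wt i` at `p`
      have hw_fd : ∀ i, HasFDerivAt (fun V : EuclideanSpace ℝ (Fin n) => fderiv ℝ η V (b i))
          ((ContinuousLinearMap.apply ℝ ℝ (b i)).comp (fderiv ℝ (fderiv ℝ η) (Function.uncurry Ubar p)))
          (Function.uncurry Ubar p) := fun i =>
        (ContinuousLinearMap.apply ℝ ℝ (b i)).hasFDerivAt.comp _ (hη2d _ hpD).hasFDerivAt
      have hWt_fd : ∀ i, HasFDerivAt (Wt i)
          (((ContinuousLinearMap.apply ℝ ℝ (b i)).comp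
            (fderiv ℝ (fderiv ℝ η) (Function.uncurry Ubar p))).comp
            (fderiv ℝ (Function.uncurry Ubar) p)) p := by
        intro i
        have h1 := hasFDerivAt_extension (θ := fun V => fderiv ℝ η V (b i)) (hWeq i) hpo hd
          (hw_fd i).differentiableAt
        rw [(hw_fd i).fderiv] at h1
        exact h1
      -- derivative of `Φ i = ψ * Wt i` at `p`
      have hΦ_fd : ∀ i v, fderiv ℝ (Φ i) p v
          = fderiv ℝ ψ p v * fderiv ℝ η (Function.uncurry Ubar p) (b i)
            + ψ p * fderiv ℝ (fderiv ℝ η) (Function.uncurry Ubar p)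
                (fderiv ℝ (Function.uncurry Ubar) p v) (b i) := by
        intro i v
        have h1 := ((hψd p).hasFDerivAt.mul (hWt_fd i)).fderiv
        have h2 : fderiv ℝ (Φ i) p = fderiv ℝ (ψ * Wt i) p := rfl
        rw [h2, h1]
        simp only [add_apply, smul_apply, ContinuousLinearMap.comp_apply,
          ContinuousLinearMap.apply_apply, smul_eq_mul, hWeq i p hpc]
        ring
      -- expand the sum over `i`
      have hexp : ∀ (v : ℝ × EuclideanSpace ℝ (Fin m)) (X : EuclideanSpace ℝ (Fin n)),
          ∑ i : Fin n, fderiv ℝ (Φ i) p v * X i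
            = fderiv ℝ ψ p v * fderiv ℝ η (Function.uncurry Ubar p) X
              + ψ p * fderiv ℝ (fderiv ℝ η) (Function.uncurry Ubar p)
                  (fderiv ℝ (Function.uncurry Ubar) p v) X := by
        intro v X
        simp_rw [hΦ_fd, add_mul, Finset.sum_add_distrib, mul_assoc, ← Finset.mul_sum]
        rw [sum_apply_single_mul, sum_apply_single_mul]
      -- the system at `p`, and the symmetry (4.3.2)
      have hUt : fderiv ℝ (Function.uncurry Ubar) p e₀
          = -∑ α : Fin m, fderiv ℝ (G α) (Function.uncurry Ubar p)
              (fderiv ℝ (Function.uncurry Ubar) p (e α)) := eq_neg_of_add_eq_zero_left hsysp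
      have hsym : ∀ α (a c : EuclideanSpace ℝ (Fin n)),
          fderiv ℝ (fderiv ℝ η) (Function.uncurry Ubar p) (fderiv ℝ (G α) (Function.uncurry Ubar p) a) c
            = fderiv ℝ (fderiv ℝ η) (Function.uncurry Ubar p) a
                (fderiv ℝ (G α) (Function.uncurry Ubar p) c) := by
        intro α a c
        rw [fderiv_fderiv_symm hO hη2 (hD hpD), fderiv_fderiv_apply_fderiv_symm hO hη2 (hG2 α)
          (hq2 α) (fun V hV => hcompat V hV α) (hD hpD)]
      have htime : fderiv ℝ (fderiv ℝ η) (Function.uncurry Ubar p)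
          (fderiv ℝ (Function.uncurry Ubar) p e₀) (U p.1 p.2 - Ubar p.1 p.2)
          = -∑ α : Fin m, fderiv ℝ (fderiv ℝ η) (Function.uncurry Ubar p)
              (fderiv ℝ (Function.uncurry Ubar) p (e α))
              (fderiv ℝ (G α) (Function.uncurry Ubar p) (U p.1 p.2 - Ubar p.1 p.2)) := by
        rw [hUt, map_neg, map_sum, neg_apply, sum_apply]
        congr 1
        exact Finset.sum_congr rfl fun α _ => hsym α _ _
      -- conclude the pointwise identity
      have hswap : ∑ i : Fin n, ∑ α : Fin m, fderiv ℝ (Φ i) p (e α)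
            * (G α (U p.1 p.2) - G α (Ubar p.1 p.2)) i
          = ∑ α : Fin m, ∑ i : Fin n, fderiv ℝ (Φ i) p (e α)
            * (G α (U p.1 p.2) - G α (Ubar p.1 p.2)) i := Finset.sum_comm
      have hcd_p : cd p
          = (fderiv ℝ ψ p e₀ * fderiv ℝ η (Function.uncurry Ubar p) (U p.1 p.2 - Ubar p.1 p.2)
              + ψ p * fderiv ℝ (fderiv ℝ η) (Function.uncurry Ubar p)
                  (fderiv ℝ (Function.uncurry Ubar) p e₀) (U p.1 p.2 - Ubar p.1 p.2))
            + ∑ α : Fin m, (fderiv ℝ ψ p (e α)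
                * fderiv ℝ η (Function.uncurry Ubar p) (G α (U p.1 p.2) - G α (Ubar p.1 p.2))
              + ψ p * fderiv ℝ (fderiv ℝ η) (Function.uncurry Ubar p)
                  (fderiv ℝ (Function.uncurry Ubar) p (e α))
                  (G α (U p.1 p.2) - G α (Ubar p.1 p.2))) := by
        simp only [hcd]
        rw [Finset.sum_add_distrib, hswap, hexp]
        simp_rw [hexp]
      have hg_p : ψ p * g p = ∑ α : Fin m,
          (ψ p * fderiv ℝ (fderiv ℝ η) (Ubar p.1 p.2) (fderiv ℝ (Function.uncurry Ubar) p (e α))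
              (G α (U p.1 p.2) - G α (Ubar p.1 p.2))
            - ψ p * fderiv ℝ (fderiv ℝ η) (Ubar p.1 p.2) (fderiv ℝ (Function.uncurry Ubar) p (e α))
              (fderiv ℝ (G α) (Ubar p.1 p.2) (U p.1 p.2 - Ubar p.1 p.2))) := by
        simp only [hg, Finset.mul_sum, map_sub, mul_sub]
      rw [hcd_p, hg_p, htime]
      simp only [hCterm, hUnc, mul_neg, Finset.mul_sum, Finset.sum_add_distrib,
        Finset.sum_sub_distrib]
      ring
    · -- off the support everything vanishes
      have h0 : ψ p = 0 := image_eq_zero_of_notMem_tsupport hps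
      simp only [hcd, hCterm, hDΦ0 _ p hps, hDψ0 p hps, h0, zero_apply,
        zero_mul, Finset.sum_const_zero, add_zero]
  ----------------------------------------------------------------
  -- integrability of `Cterm`, `ψ g`, and of the entropy integrands
  ----------------------------------------------------------------
  have hDη_m := aestronglyMeasurable_comp_slab (θ := fderiv ℝ η)
      (V := fun p : ℝ × EuclideanSpace ℝ (Fin m) => Ubar p.1 p.2) hO
      (hη1.continuousOn_fderiv_of_isOpen hO le_rfl) hSm hŪm (fun p hp => hD (hSD_Ū p hp))
  have hD2η_m := aestronglyMeasurable_comp_slab (θ := fderiv ℝ (fderiv ℝ η))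
      (V := fun p : ℝ × EuclideanSpace ℝ (Fin m) => Ubar p.1 p.2) hO
      ((hη2.fderiv_of_isOpen hO le_rfl).continuousOn_fderiv_of_isOpen hO le_rfl) hSm hŪm
      (fun p hp => hD (hSD_Ū p hp))
  have hDG_m := fun α => aestronglyMeasurable_comp_slab (θ := fderiv ℝ (G α))
      (V := fun p : ℝ × EuclideanSpace ℝ (Fin m) => Ubar p.1 p.2) hO
      ((hG1 α).continuousOn_fderiv_of_isOpen hO le_rfl) hSm hŪm (fun p hp => hD (hSD_Ū p hp))
  have hη_mU : AEStronglyMeasurable (fun p : ℝ × EuclideanSpace ℝ (Fin m) => η (U p.1 p.2))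
      (volume.restrict S) :=
    aestronglyMeasurable_comp_slab (θ := η)
      (V := fun p : ℝ × EuclideanSpace ℝ (Fin m) => U p.1 p.2) hO
      hηs.continuousOn hSm hUm (fun p hp => hD (hSD_U p hp))
  have hη_mŪ : AEStronglyMeasurable (fun p : ℝ × EuclideanSpace ℝ (Fin m) => η (Ubar p.1 p.2))
      (volume.restrict S) :=
    aestronglyMeasurable_comp_slab (θ := η)
      (V := fun p : ℝ × EuclideanSpace ℝ (Fin m) => Ubar p.1 p.2) hO
      hηs.continuousOn hSm hŪm (fun p hp => hD (hSD_Ū p hp))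
  have hq_mU : ∀ α, AEStronglyMeasurable (fun p : ℝ × EuclideanSpace ℝ (Fin m) => q α (U p.1 p.2))
      (volume.restrict S) := fun α =>
    aestronglyMeasurable_comp_slab (θ := q α)
      (V := fun p : ℝ × EuclideanSpace ℝ (Fin m) => U p.1 p.2) hO
      (hqs α).continuousOn hSm hUm (fun p hp => hD (hSD_U p hp))
  have hq_mŪ : ∀ α, AEStronglyMeasurable (fun p : ℝ × EuclideanSpace ℝ (Fin m) => q α (Ubar p.1 p.2))
      (volume.restrict S) := fun α =>
    aestronglyMeasurable_comp_slab (θ := q α)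
      (V := fun p : ℝ × EuclideanSpace ℝ (Fin m) => Ubar p.1 p.2) hO
      (hqs α).continuousOn hSm hŪm (fun p hp => hD (hSD_Ū p hp))
  -- a scalar bounded a.e.-measurable factor times a continuous compactly supported prefactor
  have hprod : ∀ (c : ℝ × EuclideanSpace ℝ (Fin m) → ℝ) (w : ℝ × EuclideanSpace ℝ (Fin m) → ℝ) (M : ℝ),
      Continuous c → HasCompactSupport c → AEStronglyMeasurable w (volume.restrict S) →
      (∀ p ∈ S, ‖w p‖ ≤ M) → Integrable (fun p => c p * w p) (volume.restrict S) := by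
    intro c w M hc hcs hw hwM
    have := integrable_smul_of_norm_le (μ := volume.restrict S) hc hcs hw (M := M)
      (by filter_upwards [hSmem] with p hp; exact hwM p hp)
    simpa only [smul_eq_mul] using this
  -- `Cterm`
  have hC1m : AEStronglyMeasurable (fun p : ℝ × EuclideanSpace ℝ (Fin m) =>
      fderiv ℝ η (Ubar p.1 p.2) (U p.1 p.2 - Ubar p.1 p.2)) (volume.restrict S) := by
    have := ContinuousLinearMap.aestronglyMeasurable_comp₂ (ContinuousLinearMap.id ℝ _) hDη_m
      (hu_U.sub hu_Ū)
    simpa only [ContinuousLinearMap.coe_id', id_eq, Pi.sub_apply] using this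
  have hC2m : ∀ α, AEStronglyMeasurable (fun p : ℝ × EuclideanSpace ℝ (Fin m) =>
      fderiv ℝ η (Ubar p.1 p.2) (G α (U p.1 p.2) - G α (Ubar p.1 p.2))) (volume.restrict S) := by
    intro α
    have := ContinuousLinearMap.aestronglyMeasurable_comp₂ (ContinuousLinearMap.id ℝ _) hDη_m
      ((hg_U α).sub (hg_Ū α))
    simpa only [ContinuousLinearMap.coe_id', id_eq, Pi.sub_apply] using this
  have hC1b : ∀ p ∈ S, ‖fderiv ℝ η (Ubar p.1 p.2) (U p.1 p.2 - Ubar p.1 p.2)‖ ≤ M1 * (CU + CŪ) := by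
    intro p hp
    refine (le_opNorm _ _).trans (mul_le_mul (hM1 _ (hSD_Ū p hp)) ((norm_sub_le _ _).trans
      (add_le_add (hUC p.1 (Ioo_subset_Ico_self hp.1) p.2) (hŪC p.1 (Ioo_subset_Ico_self hp.1) p.2)))
      (norm_nonneg _) hM1nn)
  have hC2b : ∀ α, ∀ p ∈ S, ‖fderiv ℝ η (Ubar p.1 p.2) (G α (U p.1 p.2) - G α (Ubar p.1 p.2))‖
      ≤ M1 * (MG + MG) := by
    intro α p hp
    refine (le_opNorm _ _).trans (mul_le_mul (hM1 _ (hSD_Ū p hp)) ((norm_sub_le _ _).trans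
      (add_le_add (hGM_U α p.1 hp.1 p.2) (hGM_Ū α p.1 hp.1 p.2))) (norm_nonneg _) hM1nn)
  have hCint1 : Integrable (fun p => fderiv ℝ ψ p e₀
      * fderiv ℝ η (Ubar p.1 p.2) (U p.1 p.2 - Ubar p.1 p.2)) (volume.restrict S) :=
    hprod _ _ _ (hDψcont e₀) (hDψcs e₀) hC1m hC1b
  have hCint2 : ∀ α, Integrable (fun p => fderiv ℝ ψ p (e α)
      * fderiv ℝ η (Ubar p.1 p.2) (G α (U p.1 p.2) - G α (Ubar p.1 p.2))) (volume.restrict S) :=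
    fun α => hprod _ _ _ (hDψcont (e α)) (hDψcs (e α)) (hC2m α) (hC2b α)
  have hCint : Integrable Cterm (volume.restrict S) := by
    simp only [hCterm]
    exact hCint1.add (integrable_finsetSum _ fun α _ => hCint2 α)
  -- `ψ g`
  have hZm : ∀ α, AEStronglyMeasurable (fun p : ℝ × EuclideanSpace ℝ (Fin m) =>
      G α (U p.1 p.2) - G α (Ubar p.1 p.2)
        - fderiv ℝ (G α) (Ubar p.1 p.2) (U p.1 p.2 - Ubar p.1 p.2)) (volume.restrict S) := by
    intro α
    have := ContinuousLinearMap.aestronglyMeasurable_comp₂ (ContinuousLinearMap.id ℝ _) (hDG_m α)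
      (hu_U.sub hu_Ū)
    simp only [ContinuousLinearMap.coe_id', id_eq, Pi.sub_apply] at this
    exact ((hg_U α).sub (hg_Ū α)).sub this
  have hdŪm : ∀ α, AEStronglyMeasurable (fun p : ℝ × EuclideanSpace ℝ (Fin m) =>
      fderiv ℝ (Function.uncurry Ubar) p (e α)) (volume.restrict S) := fun α =>
    (measurable_fderiv_apply_const ℝ (Function.uncurry Ubar) (e α)).aestronglyMeasurable
  have hgm : AEStronglyMeasurable g (volume.restrict S) := by
    simp only [hg]
    refine Finset.aestronglyMeasurable_fun_sum _ fun α _ => ?_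
    -- `(V, a, c) ↦ D²η(V)[a, c]` is continuous on `O × ℝⁿ × ℝⁿ`
    have hcont : ContinuousOn (fun z : EuclideanSpace ℝ (Fin n) × (EuclideanSpace ℝ (Fin n)
        × EuclideanSpace ℝ (Fin n)) => fderiv ℝ (fderiv ℝ η) z.1 z.2.1 z.2.2) (O ×ˢ univ) := by
      have h1 : ContinuousOn (fun z : EuclideanSpace ℝ (Fin n) × (EuclideanSpace ℝ (Fin n)
          × EuclideanSpace ℝ (Fin n)) => fderiv ℝ (fderiv ℝ η) z.1) (O ×ˢ univ) :=
        ((hη2.fderiv_of_isOpen hO le_rfl).continuousOn_fderiv_of_isOpen hO le_rfl).comp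
          continuous_fst.continuousOn (fun z hz => hz.1)
      exact (h1.clm_apply (continuous_snd.fst.continuousOn)).clm_apply continuous_snd.snd.continuousOn
    have hV : AEStronglyMeasurable (fun p : ℝ × EuclideanSpace ℝ (Fin m) => (Ubar p.1 p.2,
        (fderiv ℝ (Function.uncurry Ubar) p (e α), G α (U p.1 p.2) - G α (Ubar p.1 p.2)
          - fderiv ℝ (G α) (Ubar p.1 p.2) (U p.1 p.2 - Ubar p.1 p.2)))) (volume.restrict S) :=
      hu_Ū.prodMk ((hdŪm α).prodMk (hZm α))
    exact aestronglyMeasurable_comp_of_continuousOn (hO.measurableSet.prod MeasurableSet.univ)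
      hcont hV ((ae_restrict_mem hSm).mono fun p hp => ⟨hD (hSD_Ū p hp), mem_univ _⟩)
  -- bound for `ψ g`: only points of `tsupport ψ ∩ S ⊆ Bo` matter, where `‖∂_αŪ‖ ≤ K`
  have hdŪb : ∀ p ∈ Bo, ∀ α, ‖fderiv ℝ (Function.uncurry Ubar) p (e α)‖ ≤ K := by
    intro p hp α
    refine (le_opNorm _ _).trans ?_
    rw [hen, mul_one]
    exact norm_fderiv_le_of_lipschitzOn ℝ (hBo_nhds p hp) hK
  set MZ : ℝ := max (MG + MG + MDG * (CU + CŪ)) 0 with hMZ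
  have hMZnn : 0 ≤ MZ := le_max_right _ _
  have hZb : ∀ α, ∀ p ∈ S, ‖G α (U p.1 p.2) - G α (Ubar p.1 p.2)
      - fderiv ℝ (G α) (Ubar p.1 p.2) (U p.1 p.2 - Ubar p.1 p.2)‖ ≤ MZ := by
    intro α p hp
    refine le_trans ?_ (le_max_left _ _)
    refine (norm_sub_le _ _).trans (add_le_add ((norm_sub_le _ _).trans (add_le_add
      (hGM_U α p.1 hp.1 p.2) (hGM_Ū α p.1 hp.1 p.2))) ((le_opNorm _ _).trans (mul_le_mul
      (hMDG α _ (hSD_Ū p hp)) ((norm_sub_le _ _).trans (add_le_add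
      (hUC p.1 (Ioo_subset_Ico_self hp.1) p.2) (hŪC p.1 (Ioo_subset_Ico_self hp.1) p.2)))
      (norm_nonneg _) ((norm_nonneg _).trans (hMDG α _ (hSD_Ū p hp))))))
  have hKnn : (0 : ℝ) ≤ K := K.2
  have hMψnn : 0 ≤ Mψ := (norm_nonneg _).trans (hMψ 0)
  have hψgb : ∀ᵐ p ∂(volume.restrict S), ‖ψ p * g p‖ ≤ Mψ * (∑ _α : Fin m, M2 * K * MZ) := by
    filter_upwards [hSmem] with p hpS
    by_cases hps : p ∈ tsupport ψ
    · have hpo : p ∈ Bo := hsupp_S p hps hpS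
      rw [norm_mul]
      refine mul_le_mul (hMψ p) ?_ (norm_nonneg _) ((norm_nonneg _).trans (hMψ p))
      simp only [hg]
      refine (norm_sum_le _ _).trans (Finset.sum_le_sum fun α _ => ?_)
      refine (le_opNorm _ _).trans (mul_le_mul ((le_opNorm _ _).trans (mul_le_mul
        (hM2 _ (hSD_Ū p hpS)) (hdŪb p hpo α) (norm_nonneg _) hM2nn)) (hZb α p hpS)
        (norm_nonneg _) (mul_nonneg hM2nn hKnn))
    · have h0 : ψ p = 0 := image_eq_zero_of_notMem_tsupport hps
      rw [h0, zero_mul, norm_zero]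
      exact mul_nonneg hMψnn (Finset.sum_nonneg fun α _ =>
        mul_nonneg (mul_nonneg hM2nn hKnn) hMZnn)
  have hψgint : Integrable (fun p => ψ p * g p) (volume.restrict S) :=
    integrable_restrict_of_norm_le_of_eq_zero hSm hψc.isCompact
      (hψ.continuous.aestronglyMeasurable.mul hgm) hψgb
      (fun p hp => by rw [image_eq_zero_of_notMem_tsupport hp, zero_mul])
  -- the entropy integrands
  set FU : ℝ × EuclideanSpace ℝ (Fin m) → ℝ := fun p =>
    fderiv ℝ ψ p e₀ * η (U p.1 p.2) + ∑ α : Fin m, fderiv ℝ ψ p (e α) * q α (U p.1 p.2) with hFU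
  set FŪ : ℝ × EuclideanSpace ℝ (Fin m) → ℝ := fun p =>
    fderiv ℝ ψ p e₀ * η (Ubar p.1 p.2) + ∑ α : Fin m, fderiv ℝ ψ p (e α) * q α (Ubar p.1 p.2)
    with hFŪ
  have hFUint : Integrable FU (volume.restrict S) := by
    simp only [hFU]
    refine (hprod _ _ Mall (hDψcont e₀) (hDψcs e₀) hη_mU fun p hp => hηM_U p.1 hp.1 p.2).add
      (integrable_finsetSum _ fun α _ => ?_)
    exact hprod _ _ Mall (hDψcont (e α)) (hDψcs (e α)) (hq_mU α) fun p hp => hqM_U α p.1 hp.1 p.2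
  have hηM_Ū : ∀ t ∈ Ioo 0 T, ∀ x, ‖η (Ubar t x)‖ ≤ Mall := fun t ht x =>
    (hMη _ (hŪD t (Ioo_subset_Ico_self ht) x)).trans (le_max_left _ _)
  have hqM_Ū : ∀ α, ∀ t ∈ Ioo 0 T, ∀ x, ‖q α (Ubar t x)‖ ≤ Mall := fun α t ht x =>
    (hMq α _ (hŪD t (Ioo_subset_Ico_self ht) x)).trans (le_max_right _ _)
  have hFŪint : Integrable FŪ (volume.restrict S) := by
    simp only [hFŪ]
    refine (hprod _ _ Mall (hDψcont e₀) (hDψcs e₀) hη_mŪ fun p hp => hηM_Ū p.1 hp.1 p.2).add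
      (integrable_finsetSum _ fun α _ => ?_)
    exact hprod _ _ Mall (hDψcont (e α)) (hDψcs (e α)) (hq_mŪ α) fun p hp => hqM_Ū α p.1 hp.1 p.2
  ----------------------------------------------------------------
  -- Step (V): assembly
  ----------------------------------------------------------------
  have hsum0 : (∫ p in S, Cterm p) + ∫ p in S, ψ p * g p = 0 := by
    rw [← integral_add hCint hψgint, ← hcd0]
    exact (integral_congr_ae hident).symm
  -- the target integrand is `FU - FŪ - Cterm`
  have htarget : ∫ p in S, (fderiv ℝ ψ p e₀
          * (η (U p.1 p.2) - η (Ubar p.1 p.2) - fderiv ℝ η (Ubar p.1 p.2) (U p.1 p.2 - Ubar p.1 p.2))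
        + ∑ α : Fin m, fderiv ℝ ψ p (e α)
          * (q α (U p.1 p.2) - q α (Ubar p.1 p.2)
            - fderiv ℝ η (Ubar p.1 p.2) (G α (U p.1 p.2) - G α (Ubar p.1 p.2))))
      = (∫ p in S, FU p) - (∫ p in S, FŪ p) - ∫ p in S, Cterm p := by
    have hA : ∫ p in S, (FU p - FŪ p) = (∫ p in S, FU p) - ∫ p in S, FŪ p :=
      integral_sub hFUint hFŪint
    have hB : ∫ p in S, ((FU p - FŪ p) - Cterm p) = (∫ p in S, (FU p - FŪ p)) - ∫ p in S, Cterm p :=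
      integral_sub (hFUint.sub hFŪint) hCint
    rw [← hA, ← hB]
    refine integral_congr_ae (ae_of_all _ fun p => ?_)
    simp only [hFU, hFŪ, hCterm, mul_sub, Finset.sum_sub_distrib]
    ring
  have hRHSint : Integrable (fun p : ℝ × EuclideanSpace ℝ (Fin m) => fderiv ℝ ψ p e₀
          * (η (U p.1 p.2) - η (Ubar p.1 p.2) - fderiv ℝ η (Ubar p.1 p.2) (U p.1 p.2 - Ubar p.1 p.2))
        + ∑ α : Fin m, fderiv ℝ ψ p (e α)
          * (q α (U p.1 p.2) - q α (Ubar p.1 p.2)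
            - fderiv ℝ η (Ubar p.1 p.2) (G α (U p.1 p.2) - G α (Ubar p.1 p.2))))
      (volume.restrict S) := by
    refine ((hFUint.sub hFŪint).sub hCint).congr (ae_of_all _ fun p => ?_)
    simp only [hFU, hFŪ, hCterm, Pi.sub_apply, mul_sub, Finset.sum_sub_distrib]
    ring
  refine ⟨hψgint, hRHSint, ?_⟩
  rw [htarget]
  have hI' : 0 ≤ (∫ p in S, FU p) + ∫ x, ψ (0, x) * η (Ubar 0 x) := hI
  have hII' : (∫ p in S, FŪ p) + ∫ x, ψ (0, x) * η (Ubar 0 x) = 0 := hII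
  linarith

end Literature.Analysis.PDE.ConservationLaw

/-!
# Weak–strong uniqueness for systems of conservation laws with a convex entropy (proof)

Topic `Literature/Analysis/PDE`. Final layer: the discharge
`theorem dafermos_weak_strong_uniqueness_holds : dafermos_weak_strong_uniqueness` of the named
fact of `ConservationLawWeakStrong.lean` — the "In particular" of Dafermos, *Hyperbolic
Conservation Laws in Continuum Physics* (2000), Theorem 5.2.1 (PDF pp. 126–128 of the held scan of
the 2000 printing): a classical solution `Ū` with values in a convex compact `𝒟` is the unique
admissible weak solution with its initial data and values in `𝒟`.

We follow the printed proof ((5.2.10)–(5.2.14)) starting from the relative entropy inequality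
(5.2.10) with equal initial data (`relEntropy_ineq`). The only deviation is in the last, Gronwall,
step: instead of Dafermos' Lipschitz cutoffs (5.2.11)–(5.2.12) and Lebesgue points in `t`, we test
(5.2.10) with the smooth product `ψ(t,x) = Θ(t) χ(t,x)`, where
`χ(t,x) = ρ(√(1+|x|²) + s t)` is a smooth decreasing profile of the cone variable (so that
`∂ₜχ h + ∑ ∂_αχ f_α ≤ 0` by `|f| ≤ s h`, exactly as the "second integral … is nonnegative by
account of (5.2.5)" on p. 128) and `Θ(t) = e^{-bt} θ₀(t)` with `θ₀' = -β ≤ 0` a bump: the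
exponential weight absorbs the Gronwall term `b ∫ ψ h` (`|∑ ∂_αŪᵀD²η Z_α| ≤ b h`, "of quadratic
order", p. 128), leaving `∫ e^{-bt} β χ h ≤ 0`, whence `h(U,Ū) = 0`, i.e. `U = Ū` (positive
definiteness of `h`), a.e. on the region `{β > 0, χ = 1}`; a countable family of such regions
exhausts the slab. Locally Lipschitz `Ū` suffices since everything happens on one box
`[0,T'] × B̄(0,R)`.

* `exists_timeProfile`, `exists_coneCutoff` — the smooth cutoffs (theorems of existence, no defs);
* `dafermos_weak_strong_uniqueness_holds` — the discharge.

[cite: Dafermos2000, Thm 5.2.1]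

## References

* C. M. Dafermos, *Hyperbolic Conservation Laws in Continuum Physics*, Springer 2000, §5.2,
  Thm 5.2.1, pp. 126–128 [Dafermos2000]; C. M. Dafermos, Arch. Rational Mech. Anal. 70 (1979)
  167–179 [Dafermos1979]; R. J. DiPerna, Indiana Univ. Math. J. 28 (1979) 137–188.
-/


open MeasureTheory Set Filter Metric ContinuousLinearMap
open scoped Topology NNReal BigOperators

namespace Literature.Analysis.PDE.ConservationLaw

variable {m n : ℕ}

/-! ## The time profile `Θ(t) = e^{-bt} θ₀(t)`, `θ₀' = -β` -/

/-- **Time profile.** For `b, τ ∈ ℝ` and `ε > 0` there are `Θ ∈ C¹_c(ℝ)`, `Θ ≥ 0`, vanishing for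
`t ≥ τ + ε`, and a continuous `β ≥ 0`, positive on `(τ-ε, τ+ε)`, with
`Θ'(t) = -b Θ(t) - e^{-bt} β(t)` for `t ≥ 0`. (Take `β` a bump, `θ₀(t) = ∫_t^{τ+ε} β`,
`Θ = κ e^{-bt} θ₀` with `κ` a smooth cutoff of `(-∞,-1]` equal to `1` on `[-1/2,∞)`.) [folklore] -/
theorem exists_timeProfile (b τ ε : ℝ) (hε : 0 < ε) :
    ∃ Θ β : ℝ → ℝ, ContDiff ℝ 1 Θ ∧ (∀ t, t ≤ -1 → Θ t = 0) ∧ (∀ t, 0 ≤ Θ t) ∧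
      (∀ t, τ + ε ≤ t → Θ t = 0) ∧ Continuous β ∧ (∀ t, 0 ≤ β t) ∧
      (∀ t ∈ Ioo (τ - ε) (τ + ε), 0 < β t) ∧ (∀ t, t ∉ Ioo (τ - ε) (τ + ε) → β t = 0) ∧
      ∀ t, 0 ≤ t → HasDerivAt Θ (-b * Θ t - Real.exp (-b * t) * β t) t := by
  -- the bump `β`
  let B : ContDiffBump τ := ⟨ε / 2, ε, by positivity, by linarith⟩
  set β : ℝ → ℝ := fun t => B t with hβ
  have hβc : Continuous β := B.continuous
  have hβnn : ∀ t, 0 ≤ β t := fun t => B.nonneg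
  have hβpos : ∀ t ∈ Ioo (τ - ε) (τ + ε), 0 < β t := by
    intro t ht
    apply B.pos_of_mem_ball
    rw [mem_ball, Real.dist_eq, abs_lt]
    constructor <;> linarith [ht.1, ht.2]
  have hβout : ∀ t, t ∉ Ioo (τ - ε) (τ + ε) → β t = 0 := by
    intro t ht
    apply B.zero_of_le_dist
    show ε ≤ dist t τ
    rw [Real.dist_eq]
    by_contra h
    push Not at h
    rw [abs_lt] at h
    exact ht ⟨by linarith [h.1], by linarith [h.2]⟩
  have hβzero : ∀ t, τ + ε ≤ t → β t = 0 := fun t ht =>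
    hβout t fun h => not_le.2 h.2 ht
  -- `θ₀(t) = ∫_t^{τ+ε} β`
  set θ₀ : ℝ → ℝ := fun t => ∫ u in t..(τ + ε), β u with hθ₀
  have hθ₀d : ∀ t, HasDerivAt θ₀ (-β t) t := fun t =>
    intervalIntegral.integral_hasDerivAt_left (hβc.intervalIntegrable _ _)
      (hβc.stronglyMeasurableAtFilter _ _) hβc.continuousAt
  have hθ₀diff : Differentiable ℝ θ₀ := fun t => (hθ₀d t).differentiableAt
  have hθ₀deriv : deriv θ₀ = fun t => -β t := funext fun t => (hθ₀d t).deriv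
  have hθ₀C1 : ContDiff ℝ 1 θ₀ := by
    rw [contDiff_one_iff_deriv]
    exact ⟨hθ₀diff, by rw [hθ₀deriv]; exact hβc.neg⟩
  have hθ₀zero : ∀ t, τ + ε ≤ t → θ₀ t = 0 := by
    intro t ht
    simp only [hθ₀]
    rw [intervalIntegral.integral_symm, intervalIntegral.integral_of_le ht]
    rw [setIntegral_congr_fun measurableSet_Ioc (g := fun _ => (0 : ℝ)) fun u hu =>
      hβzero u hu.1.le]
    simp
  have hθ₀nn : ∀ t, 0 ≤ θ₀ t := by
    intro t
    by_cases ht : t ≤ τ + ε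
    · exact intervalIntegral.integral_nonneg ht fun u _ => hβnn u
    · rw [hθ₀zero t (le_of_not_ge ht)]
  -- the cutoff `κ` of the far past
  set κ : ℝ → ℝ := fun t => Real.smoothTransition (2 * t + 2) with hκ
  have hκC : ContDiff ℝ 1 κ :=
    Real.smoothTransition.contDiff.comp ((contDiff_const.mul contDiff_id).add contDiff_const)
  have hκone : ∀ t, -1 / 2 ≤ t → κ t = 1 := fun t ht =>
    Real.smoothTransition.one_of_one_le (by linarith)
  have hκzero : ∀ t, t ≤ -1 → κ t = 0 := fun t ht =>
    Real.smoothTransition.zero_of_nonpos (by linarith)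
  have hκnn : ∀ t, 0 ≤ κ t := fun t => Real.smoothTransition.nonneg _
  -- the profile
  set E : ℝ → ℝ := fun t => Real.exp (-b * t) with hE
  have hEd : ∀ t, HasDerivAt E (Real.exp (-b * t) * -b) t := fun t => by
    have h := ((hasDerivAt_id t).const_mul (-b)).exp
    refine h.congr_deriv ?_
    simp only [id_eq, mul_one]
  have hEC : ContDiff ℝ 1 E := Real.contDiff_exp.comp (contDiff_const.mul contDiff_id)
  set Θ : ℝ → ℝ := fun t => κ t * (E t * θ₀ t) with hΘ
  refine ⟨Θ, β, hκC.mul (hEC.mul hθ₀C1), ?_, ?_, ?_, hβc, hβnn, hβpos, hβout, ?_⟩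
  · intro t ht
    simp only [hΘ, hκzero t ht, zero_mul]
  · intro t
    exact mul_nonneg (hκnn t) (mul_nonneg (Real.exp_pos _).le (hθ₀nn t))
  · intro t ht
    simp only [hΘ, hθ₀zero t ht, mul_zero]
  · intro t ht
    -- near `t ≥ 0`, `κ = 1` and `Θ = E θ₀`
    have hev : Θ =ᶠ[𝓝 t] fun s => E s * θ₀ s := by
      have ho : IsOpen {s : ℝ | -1 / 2 < s} := isOpen_lt continuous_const continuous_id
      filter_upwards [ho.mem_nhds (show -1 / 2 < t by linarith)] with s hs
      simp only [hΘ, hκone s (le_of_lt hs), one_mul]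
    have hd : HasDerivAt (fun s => E s * θ₀ s) (Real.exp (-b * t) * -b * θ₀ t + E t * -β t) t :=
      (hEd t).mul (hθ₀d t)
    have hΘt : Θ t = E t * θ₀ t := by simp only [hΘ, hκone t (by linarith), one_mul]
    refine (hd.congr_of_eventuallyEq hev).congr_deriv ?_
    rw [hΘt]
    simp only [hE]
    ring

/-! ## The cone cutoff `χ(t,x) = ρ(√(1+|x|²) + s t)` -/

/-- The smooth radius `r(x) = √(1 + |x|²)` has derivative of norm at most one. [folklore] -/
theorem hasFDerivAt_sqrt_one_add_norm_sq (x : EuclideanSpace ℝ (Fin m)) :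
    HasFDerivAt (fun x : EuclideanSpace ℝ (Fin m) => Real.sqrt (1 + ‖x‖ ^ 2))
      ((1 / (2 * Real.sqrt (1 + ‖x‖ ^ 2))) • ((2 : ℕ) • innerSL ℝ x)) x := by
  have h1 : HasFDerivAt (fun x : EuclideanSpace ℝ (Fin m) => 1 + ‖x‖ ^ 2) ((2 : ℕ) • innerSL ℝ x) x :=
    ((hasStrictFDerivAt_norm_sq x).hasFDerivAt).const_add (1 : ℝ)
  exact h1.sqrt (by positivity)

/-- `|D r(x) v| ≤ ‖v‖` for `r(x) = √(1 + |x|²)`. [folklore] -/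
theorem abs_fderiv_sqrt_one_add_norm_sq_le (x v : EuclideanSpace ℝ (Fin m)) :
    |fderiv ℝ (fun x : EuclideanSpace ℝ (Fin m) => Real.sqrt (1 + ‖x‖ ^ 2)) x v| ≤ ‖v‖ := by
  rw [(hasFDerivAt_sqrt_one_add_norm_sq x).fderiv]
  have hr : 0 < Real.sqrt (1 + ‖x‖ ^ 2) := Real.sqrt_pos.2 (by positivity)
  have hxr : ‖x‖ ≤ Real.sqrt (1 + ‖x‖ ^ 2) := by
    rw [Real.le_sqrt (norm_nonneg _) (by positivity)]
    linarith
  simp only [smul_apply, innerSL_apply_apply, smul_eq_mul, nsmul_eq_mul, Nat.cast_ofNat]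
  rw [show 1 / (2 * Real.sqrt (1 + ‖x‖ ^ 2)) * (2 * inner ℝ x v)
      = inner ℝ x v / Real.sqrt (1 + ‖x‖ ^ 2) by field_simp]
  rw [abs_div, abs_of_pos hr, div_le_iff₀ hr]
  calc |inner ℝ x v| ≤ ‖x‖ * ‖v‖ := abs_real_inner_le_norm x v
    _ ≤ Real.sqrt (1 + ‖x‖ ^ 2) * ‖v‖ := mul_le_mul_of_nonneg_right hxr (norm_nonneg _)
    _ = ‖v‖ * Real.sqrt (1 + ‖x‖ ^ 2) := mul_comm _ _

/-- **Cone cutoff.** For `s, R₁ ∈ ℝ` there is `χ ∈ C¹(ℝ × ℝ^m)`, `0 ≤ χ`, with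
`χ = 1` where `√(1+|x|²) + s t < R₁`, `χ = 0` unless `√(1+|x|²) + s t < R₁ + 1`, and the transport
inequality `Dχ(1,0) h + ∑_α Dχ(0,e_α) f_α ≤ 0` whenever `h ≥ 0` and `∑_α |f_α| ≤ s h` (the profile
decreases along the cone variable at speed `s`; cf. Dafermos p. 128, "nonnegative by account of
(5.2.5)"). [folklore] -/
theorem exists_coneCutoff (s R₁ : ℝ) :
    ∃ χ : ℝ × EuclideanSpace ℝ (Fin m) → ℝ, ContDiff ℝ 1 χ ∧ (∀ p, 0 ≤ χ p) ∧
      (∀ p, Real.sqrt (1 + ‖p.2‖ ^ 2) + s * p.1 < R₁ → χ p = 1) ∧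
      (∀ p, χ p ≠ 0 → Real.sqrt (1 + ‖p.2‖ ^ 2) + s * p.1 < R₁ + 1) ∧
      ∀ (p : ℝ × EuclideanSpace ℝ (Fin m)) (hv : ℝ) (fv : Fin m → ℝ), 0 ≤ hv →
        ∑ α, |fv α| ≤ s * hv →
        fderiv ℝ χ p (1, 0) * hv
          + ∑ α, fderiv ℝ χ p (0, EuclideanSpace.single α (1 : ℝ)) * fv α ≤ 0 := by
  set r : EuclideanSpace ℝ (Fin m) → ℝ := fun x => Real.sqrt (1 + ‖x‖ ^ 2) with hr
  set y : ℝ × EuclideanSpace ℝ (Fin m) → ℝ := fun p => r p.2 + s * p.1 with hy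
  set χ : ℝ × EuclideanSpace ℝ (Fin m) → ℝ := fun p => Real.smoothTransition (R₁ + 1 - y p)
    with hχ
  have hrC : ContDiff ℝ 1 r := by
    refine ContDiff.sqrt (contDiff_const.add (contDiff_norm_sq ℝ)) fun x => ?_
    positivity
  have hyC : ContDiff ℝ 1 y :=
    (hrC.comp contDiff_snd).add (contDiff_const.mul contDiff_fst)
  have hχC : ContDiff ℝ 1 χ :=
    Real.smoothTransition.contDiff.comp (contDiff_const.sub hyC)
  -- derivative of `y`
  have hyd : ∀ p : ℝ × EuclideanSpace ℝ (Fin m), HasFDerivAt y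
      ((fderiv ℝ r p.2).comp (ContinuousLinearMap.snd ℝ ℝ (EuclideanSpace ℝ (Fin m)))
        + s • ContinuousLinearMap.fst ℝ ℝ (EuclideanSpace ℝ (Fin m))) p := by
    intro p
    have h1 : HasFDerivAt (fun p : ℝ × EuclideanSpace ℝ (Fin m) => r p.2)
        ((fderiv ℝ r p.2).comp (ContinuousLinearMap.snd ℝ ℝ (EuclideanSpace ℝ (Fin m)))) p :=
      ((hasFDerivAt_sqrt_one_add_norm_sq p.2).differentiableAt.hasFDerivAt).comp p hasFDerivAt_snd
    have h2 : HasFDerivAt (fun p : ℝ × EuclideanSpace ℝ (Fin m) => s * p.1)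
        (s • ContinuousLinearMap.fst ℝ ℝ (EuclideanSpace ℝ (Fin m))) p :=
      (hasFDerivAt_fst (p := p)).const_mul s
    exact h1.add h2
  -- derivative of `χ`
  have hsTd : ∀ z, HasDerivAt Real.smoothTransition (deriv Real.smoothTransition z) z := fun z =>
    ((Real.smoothTransition.contDiff (n := 1)).differentiable one_ne_zero z).hasDerivAt
  have hχd : ∀ (p) (v : ℝ × EuclideanSpace ℝ (Fin m)), fderiv ℝ χ p v
      = deriv Real.smoothTransition (R₁ + 1 - y p) * -(fderiv ℝ r p.2 v.2 + s * v.1) := by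
    intro p v
    have h1 := (hsTd (R₁ + 1 - y p)).comp_hasFDerivAt p ((hyd p).const_sub (R₁ + 1))
    rw [show χ = Real.smoothTransition ∘ fun p => R₁ + 1 - y p from rfl, h1.fderiv]
    simp only [smul_apply, neg_apply, add_apply, ContinuousLinearMap.comp_apply,
      ContinuousLinearMap.coe_snd', ContinuousLinearMap.coe_fst', smul_eq_mul, mul_comm s]
  have hderiv_nn : ∀ z, 0 ≤ deriv Real.smoothTransition z := fun z =>
    Real.smoothTransition.monotone.deriv_nonneg
  refine ⟨χ, hχC, fun p => Real.smoothTransition.nonneg _, ?_, ?_, ?_⟩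
  · intro p hp
    exact Real.smoothTransition.one_of_one_le (by simp only [hy] at hp ⊢; linarith)
  · intro p hp
    by_contra h
    exact hp (Real.smoothTransition.zero_of_nonpos (by push Not at h; simp only [hy]; linarith))
  · intro p hv fv hhv hfv
    have hρ : ∀ α, |fderiv ℝ r p.2 (EuclideanSpace.single α (1 : ℝ))| ≤ 1 := fun α => by
      simpa using abs_fderiv_sqrt_one_add_norm_sq_le p.2 (EuclideanSpace.single α (1 : ℝ))
    simp only [hχd, map_zero, zero_add, mul_zero, add_zero, mul_one]
    set d : ℝ := deriv Real.smoothTransition (R₁ + 1 - y p) with hd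
    have hsum : |∑ α, fderiv ℝ r p.2 (EuclideanSpace.single α (1 : ℝ)) * fv α| ≤ s * hv := by
      refine (Finset.abs_sum_le_sum_abs _ _).trans ?_
      refine le_trans (Finset.sum_le_sum fun α _ => ?_) hfv
      rw [abs_mul]
      exact mul_le_of_le_one_left (abs_nonneg _) (hρ α)
    have h1 : d * -s * hv + ∑ α, d * -(fderiv ℝ r p.2 (EuclideanSpace.single α (1 : ℝ))) * fv α
        = -d * (s * hv + ∑ α, fderiv ℝ r p.2 (EuclideanSpace.single α (1 : ℝ)) * fv α) := by
      rw [mul_add, Finset.mul_sum]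
      congr 1
      · ring
      · exact Finset.sum_congr rfl fun α _ => by ring
    rw [h1]
    have h2 : 0 ≤ s * hv + ∑ α, fderiv ℝ r p.2 (EuclideanSpace.single α (1 : ℝ)) * fv α := by
      have := neg_abs_le (∑ α, fderiv ℝ r p.2 (EuclideanSpace.single α (1 : ℝ)) * fv α)
      linarith
    have := hderiv_nn (R₁ + 1 - y p)
    nlinarith

/-- Derivative of the product `Θ(t) χ(t,x)` of a time profile and a space–time cutoff. [folklore] -/
theorem fderiv_timeProfile_mul {Θ : ℝ → ℝ} {χ : ℝ × EuclideanSpace ℝ (Fin m) → ℝ}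
    {p : ℝ × EuclideanSpace ℝ (Fin m)} {θ' : ℝ} (hΘ : HasDerivAt Θ θ' p.1)
    (hχ : DifferentiableAt ℝ χ p) (v : ℝ × EuclideanSpace ℝ (Fin m)) :
    fderiv ℝ (fun q : ℝ × EuclideanSpace ℝ (Fin m) => Θ q.1 * χ q) p v
      = Θ p.1 * fderiv ℝ χ p v + χ p * (θ' * v.1) := by
  have h1 := hΘ.comp_hasFDerivAt p
    (hasFDerivAt_fst (𝕜 := ℝ) (E := ℝ) (F := EuclideanSpace ℝ (Fin m)) (p := p))
  have h3 := h1.mul hχ.hasFDerivAt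
  rw [show (fun q : ℝ × EuclideanSpace ℝ (Fin m) => Θ q.1 * χ q) = (Θ ∘ Prod.fst) * χ from rfl,
    h3.fderiv]
  simp only [add_apply, smul_apply, ContinuousLinearMap.coe_fst', smul_eq_mul, Function.comp_apply]

/-! ## The discharge -/

set_option maxHeartbeats 3200000 in -- one long assembly proof (Dafermos (5.2.10)–(5.2.14))
/-- **Dafermos–DiPerna weak–strong uniqueness (Dafermos 2000, Thm 5.2.1, "In particular").**
For a system of conservation laws endowed with a uniformly convex entropy, a classical (locally
Lipschitz) solution `Ū` on `[0,T)` with values in a convex compact `𝒟 ⊆ 𝒪` is the unique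
admissible weak solution on `[0,T)` with initial data `Ū(·,0)` and values in `𝒟`: every such `U`
equals `Ū` a.e. on `(0,T) × ℝ^m`. Proof: Dafermos' relative entropy method, pp. 126–128 —
(5.2.10) (`relEntropy_ineq`) tested with `ψ = Θ(t)χ(t,x)` (see the module docstring), the
quadratic bounds `h ≥ (c/2)|U-Ū|²`, `|f_α|, |Z_α| ≤ C|U-Ū|²` (`relEntropy_lower`,
`fluxDefect_le`, `taylorDefect_le`) and `‖∂_αŪ‖ ≤ K` on the box.
[cite: Dafermos2000, Thm 5.2.1] -/
theorem dafermos_weak_strong_uniqueness_holds : dafermos_weak_strong_uniqueness := by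
  classical
  intro m n O G η q hsys D hD hDc hDconv T hT Ubar hŪ hŪD U hUw hUadm hUD
  haveI : (volume : Measure (ℝ × EuclideanSpace ℝ (Fin m))).IsAddHaarMeasure :=
    Measure.prod.instIsAddHaarMeasure _ _
  obtain ⟨hO, hGs, hηs, hqs, hcompat, hconv⟩ := hsys
  have hG1 : ∀ α, ContDiffOn ℝ 1 (G α) O := fun α => by exact contDiffOn_infty.1 (hGs α) 1
  have hG2 : ∀ α, ContDiffOn ℝ 2 (G α) O := fun α => by exact contDiffOn_infty.1 (hGs α) 2
  have hη1 : ContDiffOn ℝ 1 η O := by exact contDiffOn_infty.1 hηs 1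
  have hη2 : ContDiffOn ℝ 2 η O := by exact contDiffOn_infty.1 hηs 2
  have hq1 : ∀ α, ContDiffOn ℝ 1 (q α) O := fun α => by exact contDiffOn_infty.1 (hqs α) 1
  ----------------------------------------------------------------
  -- constants depending only on `D`
  ----------------------------------------------------------------
  obtain ⟨c, hcpos, hc⟩ := hconv D hD hDc
  have hc' : ∀ V ∈ D, ∀ ξ : EuclideanSpace ℝ (Fin n),
      c * ‖ξ‖ ^ 2 ≤ fderiv ℝ (fderiv ℝ η) V ξ ξ := by
    intro V hV ξ
    have := hc V hV ξ
    rw [iteratedFDeriv_two_apply] at this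
    simpa using this
  have hlow : ∀ V ∈ D, ∀ W ∈ D, c / 2 * ‖V - W‖ ^ 2 ≤ η V - η W - fderiv ℝ η W (V - W) :=
    fun V hV W hW => relEntropy_lower hO hη2 hD hDconv hc' hV hW
  obtain ⟨LDη, hLDη⟩ := exists_lipschitzOnWith_fderiv hO hη2 hD hDc hDconv
  have hMDG : ∃ M : ℝ, 0 ≤ M ∧ ∀ α, ∀ V ∈ D, ‖fderiv ℝ (G α) V‖ ≤ M := by
    have h1 : ∀ α, ∃ M : ℝ, ∀ V ∈ D, ‖fderiv ℝ (G α) V‖ ≤ M := fun α => by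
      obtain ⟨M, -, hM⟩ := exists_forall_norm_fderiv_le hO (hG1 α) hD hDc
      exact ⟨M, hM⟩
    choose Mα hMα using h1
    refine ⟨∑ α, |Mα α|, Finset.sum_nonneg fun α _ => abs_nonneg _, fun α V hV =>
      (hMα α V hV).trans ((le_abs_self _).trans ?_)⟩
    exact Finset.single_le_sum (f := fun α => |Mα α|) (fun α _ => abs_nonneg _) (Finset.mem_univ α)
  obtain ⟨MDG, hMDGnn, hMDG⟩ := hMDG
  have hLDG : ∃ L : ℝ≥0, ∀ α, LipschitzOnWith L (fderiv ℝ (G α)) D := by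
    have h1 : ∀ α, ∃ L : ℝ≥0, LipschitzOnWith L (fderiv ℝ (G α)) D := fun α =>
      exists_lipschitzOnWith_fderiv hO (hG2 α) hD hDc hDconv
    choose Lα hLα using h1
    exact ⟨∑ α, Lα α, fun α => (hLα α).weaken
      (Finset.single_le_sum (f := Lα) (fun _ _ => bot_le) (Finset.mem_univ α))⟩
  obtain ⟨LDG, hLDG⟩ := hLDG
  obtain ⟨M2, hM2nn, hM2⟩ := exists_forall_norm_fderiv_fderiv_le hO hη2 hD hDc
  -- the quadratic bounds
  set Cf : ℝ := LDη * MDG with hCf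
  have hCfnn : 0 ≤ Cf := mul_nonneg LDη.2 hMDGnn
  have hf_bd : ∀ α, ∀ V ∈ D, ∀ W ∈ D,
      |q α V - q α W - fderiv ℝ η W (G α V - G α W)| ≤ Cf * ‖V - W‖ ^ 2 :=
    fun α V hV W hW => fluxDefect_le hO hη1 (hG1 α) (hq1 α) (fun V hV => hcompat V hV α) hD hDconv
      hLDη (hMDG α) hV hW
  have hZ_bd : ∀ α, ∀ V ∈ D, ∀ W ∈ D,
      ‖G α V - G α W - fderiv ℝ (G α) W (V - W)‖ ≤ LDG * ‖V - W‖ ^ 2 :=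
    fun α V hV W hW => taylorDefect_le hO (hG1 α) hD hDconv (hLDG α) hV hW
  -- the speed `s`
  set s : ℝ := (m : ℝ) * (2 * Cf / c) + 1 with hsdef
  have hspos : 0 < s := by positivity
  -- `∑ |f_α| ≤ s h` and `h ≥ 0` on `D × D`
  have hh_nn : ∀ V ∈ D, ∀ W ∈ D, 0 ≤ η V - η W - fderiv ℝ η W (V - W) := fun V hV W hW =>
    le_trans (by positivity) (hlow V hV W hW)
  have hf_sum : ∀ V ∈ D, ∀ W ∈ D, ∑ α, |q α V - q α W - fderiv ℝ η W (G α V - G α W)|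
      ≤ s * (η V - η W - fderiv ℝ η W (V - W)) := by
    intro V hV W hW
    have hh := hlow V hV W hW
    have h1 : ∀ α, |q α V - q α W - fderiv ℝ η W (G α V - G α W)|
        ≤ 2 * Cf / c * (η V - η W - fderiv ℝ η W (V - W)) := by
      intro α
      refine (hf_bd α V hV W hW).trans ?_
      rw [show 2 * Cf / c * (η V - η W - fderiv ℝ η W (V - W))
        = Cf * (2 / c * (η V - η W - fderiv ℝ η W (V - W))) by ring]
      refine mul_le_mul_of_nonneg_left ?_ hCfnn
      rw [← div_le_iff₀' (by positivity)]
      calc ‖V - W‖ ^ 2 / (2 / c) = c / 2 * ‖V - W‖ ^ 2 := by field_simp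
        _ ≤ _ := hh
    calc ∑ α, |q α V - q α W - fderiv ℝ η W (G α V - G α W)|
        ≤ ∑ _α : Fin m, 2 * Cf / c * (η V - η W - fderiv ℝ η W (V - W)) :=
          Finset.sum_le_sum fun α _ => h1 α
      _ = (m : ℝ) * (2 * Cf / c) * (η V - η W - fderiv ℝ η W (V - W)) := by
          rw [Finset.sum_const, Finset.card_univ, Fintype.card_fin, nsmul_eq_mul]; ring
      _ ≤ s * (η V - η W - fderiv ℝ η W (V - W)) := by
          refine mul_le_mul_of_nonneg_right (by linarith) (hh_nn V hV W hW)
  ----------------------------------------------------------------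
  -- data of the solutions
  ----------------------------------------------------------------
  obtain ⟨hŪw, hŪlip⟩ := hŪ
  have hUm : Measurable (Function.uncurry U) := hUw.1
  have hŪm : Measurable (Function.uncurry Ubar) := hŪw.1
  obtain ⟨CU, hUC, -⟩ := hUw.2.2.2.2.1
  obtain ⟨CŪ, hŪC, -⟩ := hŪw.2.2.2.2.1
  obtain ⟨Mη, hMη⟩ : ∃ M : ℝ, ∀ V ∈ D, ‖η V‖ ≤ M :=
    exists_norm_le_of_continuousOn hηs.continuousOn hD hDc
  obtain ⟨M1, hM1nn, hM1⟩ := exists_forall_norm_fderiv_le hO hη1 hD hDc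
  set S : Set (ℝ × EuclideanSpace ℝ (Fin m)) := Ioo 0 T ×ˢ univ with hSdef
  have hSm : MeasurableSet S := measurableSet_Ioo.prod MeasurableSet.univ
  have hSD_U : ∀ p ∈ S, U p.1 p.2 ∈ D := fun p hp => hUD p.1 (Ioo_subset_Ico_self hp.1) p.2
  have hSD_Ū : ∀ p ∈ S, Ubar p.1 p.2 ∈ D := fun p hp => hŪD p.1 (Ioo_subset_Ico_self hp.1) p.2
  have hSmem : ∀ᵐ p ∂(volume.restrict S), p ∈ S := ae_restrict_mem hSm
  -- the relative entropy `h(U,Ū)` along the solutions is bounded and measurable on the slab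
  set hrel : ℝ × EuclideanSpace ℝ (Fin m) → ℝ := fun p =>
    η (U p.1 p.2) - η (Ubar p.1 p.2) - fderiv ℝ η (Ubar p.1 p.2) (U p.1 p.2 - Ubar p.1 p.2)
    with hhrel
  have hu_U : AEStronglyMeasurable (fun p : ℝ × EuclideanSpace ℝ (Fin m) => U p.1 p.2)
      (volume.restrict S) := hUm.aestronglyMeasurable
  have hu_Ū : AEStronglyMeasurable (fun p : ℝ × EuclideanSpace ℝ (Fin m) => Ubar p.1 p.2)
      (volume.restrict S) := hŪm.aestronglyMeasurable
  have hDη_m := aestronglyMeasurable_comp_slab (θ := fderiv ℝ η)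
      (V := fun p : ℝ × EuclideanSpace ℝ (Fin m) => Ubar p.1 p.2) hO
      (hη1.continuousOn_fderiv_of_isOpen hO le_rfl) hSm hŪm (fun p hp => hD (hSD_Ū p hp))
  have hη_mU : AEStronglyMeasurable (fun p : ℝ × EuclideanSpace ℝ (Fin m) => η (U p.1 p.2))
      (volume.restrict S) :=
    aestronglyMeasurable_comp_slab (θ := η)
      (V := fun p : ℝ × EuclideanSpace ℝ (Fin m) => U p.1 p.2) hO
      hηs.continuousOn hSm hUm (fun p hp => hD (hSD_U p hp))
  have hη_mŪ : AEStronglyMeasurable (fun p : ℝ × EuclideanSpace ℝ (Fin m) => η (Ubar p.1 p.2))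
      (volume.restrict S) :=
    aestronglyMeasurable_comp_slab (θ := η)
      (V := fun p : ℝ × EuclideanSpace ℝ (Fin m) => Ubar p.1 p.2) hO
      hηs.continuousOn hSm hŪm (fun p hp => hD (hSD_Ū p hp))
  have hhrel_m : AEStronglyMeasurable hrel (volume.restrict S) := by
    have h1 := ContinuousLinearMap.aestronglyMeasurable_comp₂ (ContinuousLinearMap.id ℝ _) hDη_m
      (hu_U.sub hu_Ū)
    simp only [ContinuousLinearMap.coe_id', id_eq, Pi.sub_apply] at h1
    exact (hη_mU.sub hη_mŪ).sub h1
  set Mh : ℝ := Mη + Mη + M1 * (CU + CŪ) with hMh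
  have hhrel_bd : ∀ p ∈ S, ‖hrel p‖ ≤ Mh := by
    intro p hp
    refine (norm_sub_le _ _).trans (add_le_add ((norm_sub_le _ _).trans (add_le_add
      (hMη _ (hSD_U p hp)) (hMη _ (hSD_Ū p hp)))) ((le_opNorm _ _).trans (mul_le_mul
      (hM1 _ (hSD_Ū p hp)) ((norm_sub_le _ _).trans (add_le_add
      (hUC p.1 (Ioo_subset_Ico_self hp.1) p.2) (hŪC p.1 (Ioo_subset_Ico_self hp.1) p.2)))
      (norm_nonneg _) hM1nn)))
  have hhrel_int : ∀ (cw : ℝ × EuclideanSpace ℝ (Fin m) → ℝ), Continuous cw → HasCompactSupport cw →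
      Integrable (fun p => cw p * hrel p) (volume.restrict S) := by
    intro cw hcw hcws
    have := integrable_smul_of_norm_le (μ := volume.restrict S) hcw hcws hhrel_m (M := Mh)
      (by filter_upwards [hSmem] with p hp; exact hhrel_bd p hp)
    simpa only [smul_eq_mul] using this
  have hhrel_nn : ∀ p ∈ S, 0 ≤ hrel p := fun p hp => hh_nn _ (hSD_U p hp) _ (hSD_Ū p hp)
  ----------------------------------------------------------------
  -- the local statement: for a valid `(T', τ, ε, R₁)`, `U = Ū` a.e. on the region
  ----------------------------------------------------------------
  have hlocal : ∀ (T' τ ε R₁ : ℝ), 0 < ε → 0 < τ - ε → τ + ε < T' → T' < T →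
      ∀ᵐ p ∂volume, p ∈ S → p.1 ∈ Ioo (τ - ε) (τ + ε) →
        Real.sqrt (1 + ‖p.2‖ ^ 2) + s * p.1 < R₁ → U p.1 p.2 = Ubar p.1 p.2 := by
    intro T' τ ε R₁ hε hτε hτT' hT'T
    have hT'0 : 0 < T' := by linarith
    -- the box and the constants depending on `Ū` there
    set R : ℝ := |R₁| + 2 + s with hRdef
    obtain ⟨K, hK⟩ := hŪlip T' hT'T R
    have hKnn : (0 : ℝ) ≤ K := K.2
    set b : ℝ := (m : ℝ) * M2 * K * LDG * (2 / c) with hbdef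
    have hbnn : 0 ≤ b := by positivity
    -- the cutoffs
    obtain ⟨Θ, β, hΘC, hΘlow, hΘnn, hΘT, hβc, hβnn, hβpos, hβout, hΘd⟩ :=
      exists_timeProfile b τ ε hε
    obtain ⟨χ, hχC, hχnn, hχone, hχsupp, hχtr⟩ := exists_coneCutoff (m := m) s R₁
    set ψ : ℝ × EuclideanSpace ℝ (Fin m) → ℝ := fun p => Θ p.1 * χ p with hψdef
    have hΘ1C : ContDiff ℝ 1 fun p : ℝ × EuclideanSpace ℝ (Fin m) => Θ p.1 := hΘC.comp contDiff_fst
    have hψC : ContDiff ℝ 1 ψ := hΘ1C.mul hχC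
    have hψnn : ∀ p, 0 ≤ ψ p := fun p => mul_nonneg (hΘnn _) (hχnn _)
    have hxr : ∀ x : EuclideanSpace ℝ (Fin m), ‖x‖ ≤ Real.sqrt (1 + ‖x‖ ^ 2) := fun x => by
      rw [Real.le_sqrt (norm_nonneg _) (by positivity)]; linarith
    -- support of `ψ`
    have hsupp_sub : Function.support ψ
        ⊆ Icc (-1) (τ + ε) ×ˢ closedBall (0 : EuclideanSpace ℝ (Fin m)) (|R₁| + 1 + s) := by
      intro p hp
      rw [Function.mem_support] at hp
      have hΘp : Θ p.1 ≠ 0 := left_ne_zero_of_mul hp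
      have hχp : χ p ≠ 0 := right_ne_zero_of_mul hp
      have ht1 : -1 ≤ p.1 := by
        by_contra h
        exact hΘp (hΘlow _ (le_of_not_ge h))
      have ht2 : p.1 ≤ τ + ε := by
        by_contra h
        exact hΘp (hΘT _ (le_of_not_ge h))
      have hy := hχsupp p hχp
      refine ⟨⟨ht1, ht2⟩, ?_⟩
      rw [mem_closedBall, dist_zero_right]
      have : -s ≤ s * p.1 := by nlinarith
      linarith [le_abs_self R₁, hxr p.2]
    have hKc : IsCompact (Icc (-1) (τ + ε) ×ˢ closedBall (0 : EuclideanSpace ℝ (Fin m))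
        (|R₁| + 1 + s)) := isCompact_Icc.prod (isCompact_closedBall _ _)
    have hψc : HasCompactSupport ψ := HasCompactSupport.of_support_subset_isCompact hKc hsupp_sub
    have hψs : tsupport ψ ⊆ Iio T' ×ˢ ball (0 : EuclideanSpace ℝ (Fin m)) R := by
      refine (closure_minimal hsupp_sub hKc.isClosed).trans ?_
      rintro ⟨t, x⟩ ⟨ht, hx⟩
      refine ⟨lt_of_le_of_lt ht.2 hτT', ?_⟩
      rw [mem_closedBall, dist_zero_right] at hx
      rw [mem_ball, dist_zero_right]
      simp only [hRdef]
      linarith [le_abs_self R₁, abs_nonneg R₁, neg_abs_le R₁]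
    ----------------------------------------------------------------
    -- (5.2.10) for `ψ`
    ----------------------------------------------------------------
    obtain ⟨hgint, hRint, hineq⟩ := relEntropy_ineq ⟨hO, hGs, hηs, hqs, hcompat, hconv⟩ hD hDc
      hDconv ⟨hŪw, hŪlip⟩ hŪD hUw hUadm hUD hT'0 hT'T hψC hψc hψnn hψs
    set e₀ : ℝ × EuclideanSpace ℝ (Fin m) := (1, 0) with he₀
    set e : Fin m → ℝ × EuclideanSpace ℝ (Fin m) :=
      fun α => (0, EuclideanSpace.single α (1 : ℝ)) with he
    have hen : ∀ α, ‖e α‖ = 1 := fun α => norm_spaceDir α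
    set gp : ℝ × EuclideanSpace ℝ (Fin m) → ℝ := fun p => ∑ α : Fin m,
      fderiv ℝ (fderiv ℝ η) (Ubar p.1 p.2) (fderiv ℝ (Function.uncurry Ubar) p (e α))
        (G α (U p.1 p.2) - G α (Ubar p.1 p.2)
          - fderiv ℝ (G α) (Ubar p.1 p.2) (U p.1 p.2 - Ubar p.1 p.2)) with hgp
    set fα : Fin m → ℝ × EuclideanSpace ℝ (Fin m) → ℝ := fun α p =>
      q α (U p.1 p.2) - q α (Ubar p.1 p.2)
        - fderiv ℝ η (Ubar p.1 p.2) (G α (U p.1 p.2) - G α (Ubar p.1 p.2)) with hfα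
    set Fp : ℝ × EuclideanSpace ℝ (Fin m) → ℝ := fun p =>
      fderiv ℝ ψ p e₀ * hrel p + ∑ α : Fin m, fderiv ℝ ψ p (e α) * fα α p with hFp
    have hgint' : Integrable (fun p => ψ p * gp p) (volume.restrict S) := hgint
    have hRint' : Integrable Fp (volume.restrict S) := hRint
    have hineq' : ∫ p in S, ψ p * gp p ≤ ∫ p in S, Fp p := hineq
    -- boxes
    set Bc : Set (ℝ × EuclideanSpace ℝ (Fin m)) := Icc 0 T' ×ˢ closedBall 0 R with hBc
    have hsupp_S : ∀ p ∈ tsupport ψ, p ∈ S → Bc ∈ 𝓝 p := by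
      intro p hp hpS
      have hpo : p ∈ Ioo 0 T' ×ˢ ball (0 : EuclideanSpace ℝ (Fin m)) R :=
        ⟨⟨hpS.1.1, (hψs hp).1⟩, (hψs hp).2⟩
      exact Filter.mem_of_superset ((isOpen_Ioo.prod isOpen_ball).mem_nhds hpo)
        (Set.prod_mono Ioo_subset_Icc_self ball_subset_closedBall)
    have hdŪb : ∀ p ∈ tsupport ψ, p ∈ S → ∀ α, ‖fderiv ℝ (Function.uncurry Ubar) p (e α)‖ ≤ K := by
      intro p hp hpS α
      refine (le_opNorm _ _).trans ?_
      rw [hen, mul_one]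
      exact norm_fderiv_le_of_lipschitzOn ℝ (hsupp_S p hp hpS) hK
    ----------------------------------------------------------------
    -- Step 1: `∫ ψ g ≥ -b ∫ ψ h`
    ----------------------------------------------------------------
    have hsq : ∀ p ∈ S, ‖U p.1 p.2 - Ubar p.1 p.2‖ ^ 2 ≤ 2 / c * hrel p := by
      intro p hp
      have := hlow _ (hSD_U p hp) _ (hSD_Ū p hp)
      rw [← div_le_iff₀' (by positivity)]
      calc ‖U p.1 p.2 - Ubar p.1 p.2‖ ^ 2 / (2 / c) = c / 2 * ‖U p.1 p.2 - Ubar p.1 p.2‖ ^ 2 := by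
            field_simp
        _ ≤ hrel p := this
    have hg_bd : ∀ p ∈ tsupport ψ, p ∈ S → |gp p| ≤ b * hrel p := by
      intro p hp hpS
      simp only [hgp]
      refine (Finset.abs_sum_le_sum_abs _ _).trans ?_
      have h1 : ∀ α, |fderiv ℝ (fderiv ℝ η) (Ubar p.1 p.2) (fderiv ℝ (Function.uncurry Ubar) p (e α))
          (G α (U p.1 p.2) - G α (Ubar p.1 p.2)
            - fderiv ℝ (G α) (Ubar p.1 p.2) (U p.1 p.2 - Ubar p.1 p.2))|
          ≤ M2 * K * LDG * (2 / c * hrel p) := by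
        intro α
        rw [← Real.norm_eq_abs]
        refine (le_opNorm _ _).trans (mul_le_mul ((le_opNorm _ _).trans (mul_le_mul
          (hM2 _ (hSD_Ū p hpS)) (hdŪb p hp hpS α) (norm_nonneg _) hM2nn))
          ((hZ_bd α _ (hSD_U p hpS) _ (hSD_Ū p hpS)).trans (mul_le_mul_of_nonneg_left (hsq p hpS)
          LDG.2)) (norm_nonneg _) (mul_nonneg hM2nn hKnn)) |>.trans ?_
        exact le_of_eq (by ring)
      calc ∑ α, |fderiv ℝ (fderiv ℝ η) (Ubar p.1 p.2) (fderiv ℝ (Function.uncurry Ubar) p (e α))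
            (G α (U p.1 p.2) - G α (Ubar p.1 p.2)
              - fderiv ℝ (G α) (Ubar p.1 p.2) (U p.1 p.2 - Ubar p.1 p.2))|
          ≤ ∑ _α : Fin m, M2 * K * LDG * (2 / c * hrel p) := Finset.sum_le_sum fun α _ => h1 α
        _ = b * hrel p := by
          rw [Finset.sum_const, Finset.card_univ, Fintype.card_fin, nsmul_eq_mul, hbdef]; ring
    have hlow_pt : ∀ p ∈ S, -b * (ψ p * hrel p) ≤ ψ p * gp p := by
      intro p hp
      by_cases hps : p ∈ tsupport ψ
      · have h1 := hg_bd p hps hp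
        have h2 := hψnn p
        have h3 : -(b * hrel p) ≤ gp p := by linarith [neg_abs_le (gp p)]
        nlinarith
      · simp [image_eq_zero_of_notMem_tsupport hps]
    have hψh_int : Integrable (fun p => ψ p * hrel p) (volume.restrict S) :=
      hhrel_int ψ hψC.continuous hψc
    have hstep1 : -b * ∫ p in S, ψ p * hrel p ≤ ∫ p in S, ψ p * gp p := by
      rw [← integral_const_mul]
      refine integral_mono_ae (hψh_int.const_mul _) hgint' ?_
      filter_upwards [hSmem] with p hp
      exact hlow_pt p hp
    ----------------------------------------------------------------
    -- Step 2: `∫ F ≤ -b ∫ ψ h - ∫ w h`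
    ----------------------------------------------------------------
    set w : ℝ × EuclideanSpace ℝ (Fin m) → ℝ := fun p => Real.exp (-b * p.1) * β p.1 * χ p with hw
    have hwc : Continuous w :=
      ((Real.continuous_exp.comp (continuous_const.mul continuous_fst)).mul
        (hβc.comp continuous_fst)).mul hχC.continuous
    have hw_supp : Function.support w
        ⊆ Icc (τ - ε) (τ + ε) ×ˢ closedBall (0 : EuclideanSpace ℝ (Fin m)) (|R₁| + 1 + s * (|τ| + ε)) := by
      intro p hp
      rw [Function.mem_support] at hp
      have hβp : β p.1 ≠ 0 := by
        intro h; apply hp; simp only [hw, h, mul_zero, zero_mul]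
      have hχp : χ p ≠ 0 := right_ne_zero_of_mul hp
      have ht : p.1 ∈ Ioo (τ - ε) (τ + ε) := by
        by_contra h; exact hβp (hβout _ h)
      refine ⟨Ioo_subset_Icc_self ht, ?_⟩
      rw [mem_closedBall, dist_zero_right]
      have hy := hχsupp p hχp
      have h1 : -(s * (|τ| + ε)) ≤ s * p.1 := by
        have : -(|τ| + ε) ≤ p.1 := by linarith [ht.1, neg_abs_le τ]
        nlinarith
      linarith [le_abs_self R₁, hxr p.2]
    have hwcs : HasCompactSupport w := HasCompactSupport.of_support_subset_isCompact
      (isCompact_Icc.prod (isCompact_closedBall _ _)) hw_supp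
    have hwh_int : Integrable (fun p => w p * hrel p) (volume.restrict S) := hhrel_int w hwc hwcs
    -- derivative of `ψ`
    have hΘ'ev : ∀ p : ℝ × EuclideanSpace ℝ (Fin m), 0 ≤ p.1 → ∀ v : ℝ × EuclideanSpace ℝ (Fin m),
        fderiv ℝ ψ p v = Θ p.1 * fderiv ℝ χ p v
          + χ p * ((-b * Θ p.1 - Real.exp (-b * p.1) * β p.1) * v.1) := fun p hp v =>
      fderiv_timeProfile_mul (hΘd p.1 hp) (hχC.differentiable one_ne_zero p) v
    have hup_pt : ∀ p ∈ S, Fp p ≤ -b * (ψ p * hrel p) - w p * hrel p := by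
      intro p hp
      have ht0 : 0 ≤ p.1 := hp.1.1.le
      have hh0 : 0 ≤ hrel p := hhrel_nn p hp
      have htr := hχtr p (hrel p) (fun α => fα α p) hh0 (hf_sum _ (hSD_U p hp) _ (hSD_Ū p hp))
      simp only [hFp, hΘ'ev p ht0]
      have h1 : ∀ α, (Θ p.1 * fderiv ℝ χ p (e α)
          + χ p * ((-b * Θ p.1 - Real.exp (-b * p.1) * β p.1) * (e α).1)) * fα α p
          = Θ p.1 * (fderiv ℝ χ p (e α) * fα α p) := by
        intro α; simp only [he]; ring
      simp_rw [h1]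
      rw [← Finset.mul_sum]
      have h2 : Θ p.1 * (fderiv ℝ χ p e₀ * hrel p) + Θ p.1 * ∑ α, fderiv ℝ χ p (e α) * fα α p ≤ 0 := by
        rw [← mul_add]
        exact mul_nonpos_of_nonneg_of_nonpos (hΘnn _) htr
      have h3 : (Θ p.1 * fderiv ℝ χ p e₀ + χ p * ((-b * Θ p.1 - Real.exp (-b * p.1) * β p.1) * e₀.1))
          * hrel p + Θ p.1 * ∑ α, fderiv ℝ χ p (e α) * fα α p
          = (Θ p.1 * (fderiv ℝ χ p e₀ * hrel p) + Θ p.1 * ∑ α, fderiv ℝ χ p (e α) * fα α p)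
            + (-b * (ψ p * hrel p) - w p * hrel p) := by
        simp only [he₀, hψdef, hw]; ring
      rw [h3]
      linarith
    have hstep2 : ∫ p in S, Fp p ≤ -b * (∫ p in S, ψ p * hrel p) - ∫ p in S, w p * hrel p := by
      rw [← integral_const_mul, ← integral_sub (hψh_int.const_mul _) hwh_int]
      refine integral_mono_ae hRint' ((hψh_int.const_mul _).sub hwh_int) ?_
      filter_upwards [hSmem] with p hp
      exact hup_pt p hp
    ----------------------------------------------------------------
    -- Step 3: `∫ w h ≤ 0`, hence `w h = 0` a.e. on the slab
    ----------------------------------------------------------------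
    have hwh0 : ∫ p in S, w p * hrel p = 0 := by
      have h1 : ∫ p in S, w p * hrel p ≤ 0 := by linarith
      have h2 : 0 ≤ ∫ p in S, w p * hrel p := by
        refine setIntegral_nonneg hSm fun p hp => mul_nonneg ?_ (hhrel_nn p hp)
        exact mul_nonneg (mul_nonneg (Real.exp_pos _).le (hβnn _)) (hχnn _)
      linarith
    have hwh_ae : ∀ᵐ p ∂(volume.restrict S), w p * hrel p = 0 := by
      have hnn : 0 ≤ᵐ[volume.restrict S] fun p => w p * hrel p := by
        filter_upwards [hSmem] with p hp
        exact mul_nonneg (mul_nonneg (mul_nonneg (Real.exp_pos _).le (hβnn _)) (hχnn _))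
          (hhrel_nn p hp)
      exact (integral_eq_zero_iff_of_nonneg_ae hnn hwh_int).1 hwh0
    ----------------------------------------------------------------
    -- Step 4: conclusion on the region `{β > 0, χ = 1}`
    ----------------------------------------------------------------
    have hfin : ∀ᵐ p ∂(volume.restrict S), p.1 ∈ Ioo (τ - ε) (τ + ε) →
        Real.sqrt (1 + ‖p.2‖ ^ 2) + s * p.1 < R₁ → U p.1 p.2 = Ubar p.1 p.2 := by
      filter_upwards [hwh_ae, hSmem] with p hp hpS ht hR₁
      have hwpos : 0 < w p := by
        simp only [hw, hχone p hR₁, mul_one]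
        exact mul_pos (Real.exp_pos _) (hβpos _ ht)
      have hh0 : hrel p = 0 := by
        rcases mul_eq_zero.1 hp with h | h
        · exact absurd h hwpos.ne'
        · exact h
      have h1 := hlow _ (hSD_U p hpS) _ (hSD_Ū p hpS)
      have h2 : hrel p = η (U p.1 p.2) - η (Ubar p.1 p.2)
          - fderiv ℝ η (Ubar p.1 p.2) (U p.1 p.2 - Ubar p.1 p.2) := rfl
      rw [← h2, hh0] at h1
      have h3 : ‖U p.1 p.2 - Ubar p.1 p.2‖ ^ 2 ≤ 0 := by
        by_contra h4
        push Not at h4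
        have : 0 < c / 2 * ‖U p.1 p.2 - Ubar p.1 p.2‖ ^ 2 := by positivity
        linarith
      have h4 : ‖U p.1 p.2 - Ubar p.1 p.2‖ = 0 := by
        nlinarith [norm_nonneg (U p.1 p.2 - Ubar p.1 p.2)]
      exact sub_eq_zero.1 (norm_eq_zero.1 h4)
    exact (ae_restrict_iff' hSm).1 hfin
  ----------------------------------------------------------------
  -- Step 5: a countable family of regions exhausts the slab
  ----------------------------------------------------------------
  have hall : ∀ i : ℚ × ℚ × ℚ × ℕ, ∀ᵐ p ∂(volume : Measure (ℝ × EuclideanSpace ℝ (Fin m))),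
      (0 < (i.2.2.1 : ℝ) ∧ 0 < (i.2.1 : ℝ) - i.2.2.1 ∧ (i.2.1 : ℝ) + i.2.2.1 < i.1 ∧ (i.1 : ℝ) < T) →
      p ∈ S → p.1 ∈ Ioo ((i.2.1 : ℝ) - i.2.2.1) (i.2.1 + i.2.2.1) →
      Real.sqrt (1 + ‖p.2‖ ^ 2) + s * p.1 < (i.2.2.2 : ℝ) → U p.1 p.2 = Ubar p.1 p.2 := by
    rintro ⟨T', τ, ε, R₁⟩
    by_cases hv : (0 < (ε : ℝ) ∧ 0 < (τ : ℝ) - ε ∧ (τ : ℝ) + ε < T' ∧ (T' : ℝ) < T)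
    · filter_upwards [hlocal T' τ ε R₁ hv.1 hv.2.1 hv.2.2.1 hv.2.2.2] with p hp _
      exact hp
    · exact ae_of_all _ fun p h => absurd h hv
  have hae := ae_all_iff.2 hall
  filter_upwards [hae] with p hp ht
  obtain ⟨T', htT', hT'T⟩ := exists_rat_btwn ht.2
  have hδ : 0 < min p.1 ((T' : ℝ) - p.1) := lt_min ht.1 (by linarith)
  obtain ⟨ε, hε0, hεδ⟩ := exists_rat_btwn (show (0 : ℝ) < min p.1 ((T' : ℝ) - p.1) / 2 by positivity)
  obtain ⟨τ, hτ1, hτ2⟩ := exists_rat_btwn (show p.1 < p.1 + ε by linarith)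
  obtain ⟨R₁, hR₁⟩ := exists_nat_gt (Real.sqrt (1 + ‖p.2‖ ^ 2) + s * p.1)
  have hmin1 := min_le_left p.1 ((T' : ℝ) - p.1)
  have hmin2 := min_le_right p.1 ((T' : ℝ) - p.1)
  exact hp ⟨T', τ, ε, R₁⟩ ⟨hε0, by linarith, by linarith, hT'T⟩ ⟨ht, mem_univ _⟩
    ⟨by linarith, by linarith⟩ hR₁

end Literature.Analysis.PDE.ConservationLaw
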